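import Mathlib
import Summits.Parity.GeneralizedHardyLittlewood.Theses.LiouvilleShiftedTables
import Summits.Parity.GeneralizedHardyLittlewood.Theorems.TableChowla.Negative.TableChowlaExceptionalSet
import Summits.Parity.GeneralizedHardyLittlewood.Theorems.LiouvilleShiftedTablesTableChowlaBVLiouville
import Summits.Parity.GeneralizedHardyLittlewood.Theorems.LiouvilleShiftedTablesTableChowlaStubInversePrimeCols
import Summits.Parity.GeneralizedHardyLittlewood.Theorems.LiouvilleShiftedTablesTableChowlaStubResidualPrimeCore
import Summits.Parity.GeneralizedHardyLittlewood.Theorems.LiouvilleShiftedTablesTableChowlaStubArchTwistPeriodicCols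
import Summits.Parity.GeneralizedHardyLittlewood.Theorems.TableChowla.Negative.TableChowlaResidualWithoutCM

/-!
# Line `helson-kronecker-inverse` — checked skeleton for crux `TableChowla` (stmt-Parity-14270)

Crux (route `LiouvilleShiftedTables`, decl
`Summit.Parity.GeneralizedHardyLittlewood.Theses.LiouvilleShiftedTables.TableChowla`): for every shift
`c ≠ 0`, every `0 < δ ≤ 1/12`, every `C > 0` and all large `x`, uniformly for `x^δ ≤ A ≤ x^{1/3+δ}`, the
fourth moment `T = tr (M_c M_cᵀ)² = ∑_{a,a'} (∑_b λ(ab+c)λ(a'b+c))²` of the shifted multiplication table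
`M_c = (λ(ab+c))_{a ∈ (⌊A⌋,⌊2A⌋], b ∈ [1,⌊x/A⌋]}` is `≤ x²/(log x)^C`.

Idea card `Ideas/helson-kronecker-inverse.md` (ideator 2; triage r1-1/2/3: pass ×3). This crux-plan
renders it in the ONE-SIDED (column) form and PROVES everything except three registered stubs, so that
the stub set is an EXACT splitting of the crux (`tableChowla_iff_stubs`, sorry-free):

  `TableChowla ↔ (InverseCM ∧ MeanSquareCMPeriodic ∧ MeanSquareCMAperiodic)`.

* PROVED the card's transfer stub `OperatorNormForm → TableChowla` ("provable now"; here
  `tableChowlaFor_of_operatorNormForm` on the landed read-back form `Negative.TableChowlaFor lam`, and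
  `operatorNormForm_iff_tableChowla`): `T = ∑_a ‖M (Mᵀe_a)‖² ≤ ‖M‖_op²·‖M‖_F² ≤ (x/(log x)^{2C+2})·2x`
  (`moment_le_of_opNorm`, finite linear algebra). Also PROVED the converse
  `operatorNormForm_of_tableChowla` (`|uᵀMv| ≤ ‖Mv‖ ≤ T^{1/4}`), so `C⁺ = OperatorNormForm ↔ crux`.
* STUB `stub_inverse : InverseCM` — THE LEVER (inverse theorem for finite Helson sections of the
  symbol `m ↦ λ(m+c)`, one-sided, quantifiers `∀ C ∃ C'` as triage r1-1/r1-2 required): if some pair of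
  `ℓ²`-unit test vectors `u, v` has `|uᵀ M_c v| ≥ √x/(log x)^C`, then some completely multiplicative
  1-bounded `g : ℕ → ℂ` and some initial segment `b ≤ y ≤ x/A` have
  `∑_{a} |∑_{b ≤ y} g(b) λ(ab+c)|² ≥ x·(x/A)/(log x)^{C'}` — a near-top right singular DIRECTION of the
  table can be taken completely multiplicative. Specific to `λ(·+c)`: the symbol-generic version is
  false (planted rank-one sign pattern on smooth rows × smooth columns; line card §Falsifier), so a
  proof must use the multiplicativity / Hecke self-similarity `λ(pm) = −λ(m)` of the symbol, as the
  card itself anticipated. Under the crux it holds vacuously (`inverseCM_of_tableChowla`, PROVED;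
  triage r1-3's point): it is a dichotomy lemma, informative only in the counterfactual branch.
* THE RESIDUAL `MeanSquareCM` (binary Elliott-type dispersion of `λ(ab+c)` against completely
  multiplicative column weights, in mean square over the dilations `a ∼ A`, every log-power saving):
  for every CM 1-bounded `g` and every `y ≤ x/A`, `∑_{a} |∑_{b ≤ y} g(b) λ(ab+c)|² ≤ x·(x/A)/(log x)^C`.
  PROVED to follow from the crux (`meanSquareCM_of_tableChowla`: `‖M g‖² ≤ ‖g‖²·√T`). It is cut by
  proof technology into two registered stubs:
  - STUB `stub_periodic : MeanSquareCMPeriodic` — weights with a period `q ≤ (log x)^K` (constants,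
    Dirichlet characters of polylogarithmic conductor: the ONE-POINT directions; the card's K2 in
    the exact form triage allowed): Bombieri–Vinogradov for `λ` with one residue and one height per
    modulus `aq ≤ 2x^{5/12}(log x)^K` = the route's support item `BVLiouville` (stmt-Parity-13324) at
    scale `3x`; Siegel–Walfisz is spent here and only here. Theorem-grade, size L.
  - STUB `stub_aperiodic : MeanSquareCMAperiodic` — all other CM weights (no period `≤ (log x)^K`, the
    prover choosing `K`): the TWO-POINT directions (`g = λ`: fixed-shift Chowla in the progressions
    `0 mod a` in mean square over `a ∼ A`; `g = n^{it}`; characters of large conductor; generic CM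
    `g`). Open-problem grade: the card's K3, widened to "binary Elliott with CM weights" as triage
    r1-2/r1-3 demanded.

LEAD RESHAPE r1 (line lead `prover-line-stmt-Parity-14270-0`, 2026-08-16): the theorem-grade stub
`stub_periodic` is split along its one unproved lean into `stub_bv : BVLiouville` (the route's support
item stmt-Parity-13324, by name) and `stub_periodic_of_bv : BVLiouville → MeanSquareCMPeriodic`
(bookkeeping, provable now), with `stub_periodic := stub_periodic_of_bv stub_bv` DERIVED; all four
registered stub signatures are inlined over Mathlib + route decls (Theorems-side files restate them
textually). Registered stubs: `stub_inverse` (lead), `stub_bv`, `stub_periodic_of_bv`, `stub_aperiodic`.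

LEAD RESHAPE r2 (2026-08-16, after wave 1 and the disprover's gen-3 vacuity finding): `stub_bv` and
`stub_periodic_of_bv` LANDED (p75572, p77485+p75692; BVLiouville proved in tree); the periodic /
aperiodic cut by `Function.Periodic g q` on `ℕ` was VOID (`Negative/TableChowlaAperiodicVacuity`), so the
residual is re-cut by COLUMN-periodicity (`ColPeriodic`): stubs `stub_periodicCols_of_bv` (theorem-grade,
proved by the lead from the landed r1 bookkeeping) and `stub_aperiodicCols` (open), composition
`meanSquareCM_of_periodicCols_aperiodicCols`; exact splitting `tableChowla_iff_stubs` /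
`tableChowla_iff_inverse_aperiodicCols : TableChowla ↔ InverseCM ∧ MeanSquareCMAperiodicCols`.

LEAD RESHAPE r3 (2026-08-16, after wave 2): the r2 column cut is VOID as well (wave-2 worker,
kernel-checked `aperiodicColsCM_iff_residualCM : MeanSquareCMAperiodicCols-as-registered ↔ MeanSquareCM`,
and the next obvious re-cut on `[1, ⌊y⌋]` too, `aperiodicAt_iff_residualCM`; paper argument: no
column-weight cut has a BV-grade side and a strictly smaller open side). The open residual is therefore
registered WHOLE as `stub_residualCM := MeanSquareCM`; the periodic theorems are kept as landed
calibrations; registered stubs: `stub_inverse` (open), `stub_residualCM` (open),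
`stub_periodicCols_of_bv` (calibration, proved, landing). Exact splitting: `tableChowla_iff_stubs :
TableChowla ↔ InverseCM ∧ MeanSquareCM`.

LEAD RESHAPE r4 (re-seated lead `prover-line-stmt-Parity-14270-1`, 2026-08-16): composition UNCHANGED
(`TableChowla_of` from `stub_inverse` + `stub_residualCM`; exact splitting `tableChowla_iff_stubs`);
`stub_periodicCols_of_bv` is now CLOSED by its landed copy (p83535). New in r4: three registered CALIBRATION stubs
that probe whether any cut of the COLUMN INDEX SET separates a lever-provable region from a residual-provable one
(the r1–r3 cuts were all cuts of the WEIGHT CLASS, and all void):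
* `stub_inverse_primeCols` (T1, theorem-grade, worker): the lever HOLDS whenever the near-extremal bilinear form lives
  on the prime columns `p` with `p² > ⌊x/A⌋` — delocalisation (`Negative.delocalise`, landed) plus CM-FREEDOM: a
  completely multiplicative weight is unconstrained on those primes (set `g(p) = 0` for `p² ≤ ⌊x/A⌋`, free above).
* `stub_residual_primeCore` (T2, theorem-grade given T1, lead): the residual `MeanSquareCM` IMPLIES the
  arbitrary-coefficient operator-norm bound for the sub-table (rows `a ∼ A`) × (prime columns `p`, `p² > ⌊x/A⌋`) —
  Type II for `λ(ap+c)` with arbitrary coefficients on both sides, every log-power saving: on the columns where CM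
  weights are free, "CM weights" means "all weights", so the one-sided residual contains the crux's unfactorable core
  there (one-sided analogue of the card's Gen-2 Lemma A).
* `stub_archTwist_periodicCols` (T3, theorem-grade, worker): the residual for column weights (q-periodic, 1-bounded)
  × (1-bounded, total variation `≤ (log x)^K` on the columns) — e.g. `χ(n)·n^{it}`, `q, |t|·log x ≤ (log x)^K` — from
  the landed BV branch by Abel summation and Cauchy–Schwarz: every major-arc pretentious direction is a theorem.
Reading of T1 ∧ T2: the lever is provable exactly where CM weights are free, and exactly there the residual is the
arbitrary-coefficient core; on the constrained (composite / small-prime) columns the residual is genuinely a CM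
statement but the lever has no mechanism. The Helson split is difficulty-neutral along column cuts as well.

LEAD RESHAPE r5 (same lead, after wave 1: T1 p87332, T2 p89573, T3 p88785 LANDED; `stub_residualCM` worker:
`stub-blocked: Negative.UniformBinaryChowla`): the ANATOMY ALONG THE FREE COLUMNS `S = {p ≤ ⌊x/A⌋ prime, p² > ⌊x/A⌋}`.
The r3/r4 stubs `stub_inverse`, `stub_residualCM` are now DERIVED (sorry-free glue `inverseCM_of_primeCols_compositeCols`,
`meanSquareCM_of_primeCore_compositeCols`, `sq_form_le_of_opNorm`) from three registered OPEN stubs: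
`stub_primeCore` (operator-norm bound with ARBITRARY coefficients on rows × S — the unstructured core, a sub-table
of the crux), `stub_inverse_compositeCols` (the lever with the near-extremal form on the complement of S),
`stub_residual_compositeCols` (the residual with the column sum on the complement of S); and the anatomy is EXACT:
`tableChowla_iff_anatomy : TableChowla ↔ PrimeCore ∧ InverseCompositeCols ∧ ResidualCompositeCols` (each piece from
the crux: `primeCore_of_tableChowla`, `inverseCompositeCols_of_tableChowla`, `residualCompositeCols_of_tableChowla`).
VERDICT PREPARED BY r5: every cut available to this line — by weight class (r1–r3, all void) or by column set (r4–r5)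
— leaves pieces of open-problem grade: on the free columns the lever is a theorem (T1) exactly because CM weights are
unconstrained there, and for the same reason the residual there is the arbitrary-coefficient core (T2 / `stub_primeCore`);
on the constrained columns the residual is a genuine CM statement (`g = λ`: dilation-averaged binary Chowla, open) and
the lever is a genuine CM-extremality statement with no known mechanism (symbol-generic version false). The Helson
split transfers difficulty between its two halves but isolates nothing below the crux except the landed calibrations.
(`stub_periodicCols_of_bv` is closed by p83535; its import stays deferred while the farm reports that module unbuilt.)

STANDING OF THE TWO OPEN STUBS (for the census; sources: `Cruxes/TableChowla/DREFUTE-helson-kronecker-inverse.md`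
v2, landed `Negative/HelsonLeverCalibration`, `Negative/TableChowlaResidualWithoutCM`,
`Negative/TableChowlaAperiodicVacuity`, `Negative/HelsonStubsLoadBearing`):
* `stub_inverse` — its CM-FREE version is a THEOREM (`Negative.inverseCM_without_CM`, delocalisation:
  truncate the near-extremal `v` at height `2(log x)^C/√B`, rescale; `C' = 4C+1`), and the residual for
  ALL 1-bounded weights is the crux itself (`Negative.meanSquareBounded_iff`); so the stub's entire content
  is the upgrade "1-bounded delocalised near-extremiser ⇒ completely multiplicative near-extremiser". It
  holds non-vacuously with explicit CM witnesses at every degenerate instance where the crux-shape fails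
  (`c = 0`: `g = λ`; one column: `g ≡ 1`; one row: CM-freedom on primes `> y/2`; Siegel ghost `χ₁ mod q₁`:
  `g = χ ≠ χ₁` via Jacobi sums), and is implied by the crux (`inverseCM_of_tableChowla`). No λ-specific
  mechanism for the CM upgrade is known; every CM-free sufficient form is crux-equivalent. Crux-sized.
* `stub_residualCM` (r3; formerly `stub_aperiodic`/`stub_aperiodicCols`, whose provisos were void) — binary
  Elliott for `(g, λ)` with ALL CM 1-bounded column weights; implied by the crux; contains dilation-averaged fixed-shift binary Chowla
  (`g = λ`), `n^{it}`, and characters of conductor `> (log x)^K` (one-point but Landau–Siegel exposed: the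
  prover must take `K ≥ C`, since an exceptional `χ₁ mod q₁`, `(log x)^K < q₁ < (log x)^C`, would make
  `g = χ ≠ χ₁ (mod q₁)` a biased weight of size `x(x/A)/q₁`). Standard-shaped open problem; crux-sized
  but strictly below the crux in logical strength as far as anyone can prove.

Composition (kernel-checked, no `sorry` outside the registered stubs): `tableChowlaFor_of_stubs :
InverseCM → MeanSquareCMPeriodic → MeanSquareCMAperiodic → Negative.TableChowlaFor Negative.lam` (pure logic)
and THE SKELETON `TableChowla_of : TableChowla := …iff.mpr (tableChowlaFor_of_stubs stub_inverse stub_periodic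
stub_aperiodic)` — the file's UNIQUE theorem concluding the crux decl by name (the hypothetical crux-named
form is the `example` next to it), via
`meanSquareCM_of_periodic_aperiodic` (excluded middle on "`g` has a period `q ≤ (log x)^K`"),
`operatorNormForm_of_inverse_msed` (take `C'` from the inverse theorem, apply the residual at level
`C'+1`; for `log x > 1` the bounds are incompatible) and the proved transfer.

Disproof.lean obligations honoured (cdisprove gen-2 v10; checked against the LANDED
`Theorems/TableChowla/Negative/*`, which this file imports): `c ≠ 0`, `0 < δ`, `δ ≤ 1/12` and both
window ends are carried VERBATIM by every statement (cf. `not_tableChowlaWithoutShiftNeZero`,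
`…WithoutDeltaPos`, `…WithoutDeltaLe`, `…WithoutLowerWindow`, `…WithoutUpperWindow`); all thresholds
are `∀ C ∃ x₀` (cf. `not_tableChowlaThresholdUniformInC`); no power saving and no polylog window is
asserted (cf. `not_tableChowlaUniformPowerSaving`, `not_tableChowlaPolylogWindow`); the pretender
refutations (`not_tableChowlaFor_one`, `not_tableChowlaFor_chi4`, `momentN_of_rankOne`) are exactly
the rank-one PERIODIC directions that `stub_periodic` must beat for `λ` with Siegel–Walfisz — the
file's stated requirement that any proof use non-pretentiousness of `λ` to real characters of small
conductor. Since every stub is implied by the crux (exact splitting), no stub is an instance of a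
refuted strengthening. Landed lemmas USED in the proofs below: `Negative.tableChowla_iff`,
`Negative.momentN_eq_colMoment`, `Negative.lam_sq_le_one`, `Negative.rows_mul_cols_le_window`,
`Negative.eventually_log_rpow_le`.
-/

namespace Summit.Parity.GeneralizedHardyLittlewood.Cruxes.TableChowla.HelsonKroneckerInverse

open Summit.Parity.GeneralizedHardyLittlewood.Theses.LiouvilleShiftedTables

/-- The shifted multiplication table entry `λ(ab+c)` as a real number (the crux's summand; for
`a > |c|` the argument is positive, so `Int.toNat` never truncates inside the window). -/
noncomputable def entry (c : ℤ) (a b : ℕ) : ℝ :=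
  (ArithmeticFunction.liouville (Int.toNat ((a : ℤ) * b + c)) : ℝ)

/-- TRANSFER TARGET `C⁺` (operator-norm form of the crux): for all `ℓ²`-unit test vectors `u` on the
rows `(⌊A⌋,⌊2A⌋]` and `v` on the columns `[1,⌊x/A⌋]`, `|∑ u_a v_b λ(ab+c)| ≤ √x/(log x)^C`, every `C`,
uniformly in the window. Equivalent to `TableChowla` (`σ₁⁴ ≤ T ≤ σ₁²·‖M‖_F²`, `‖M‖_F² ≤ 2x`). -/
def OperatorNormForm : Prop :=
  ∀ c : ℤ, c ≠ 0 → ∀ δ : ℝ, 0 < δ → δ ≤ 1 / 12 → ∀ C : ℝ, 0 < C → ∃ x₀ : ℝ, ∀ x : ℝ, x₀ ≤ x →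
    ∀ A : ℝ, x ^ δ ≤ A → A ≤ x ^ (1 / 3 + δ) →
    ∀ u v : ℕ → ℝ, (∑ a ∈ Finset.Ioc ⌊A⌋₊ ⌊2 * A⌋₊, u a ^ 2 ≤ 1) →
      (∑ b ∈ Finset.Icc 1 ⌊x / A⌋₊, v b ^ 2 ≤ 1) →
      |∑ a ∈ Finset.Ioc ⌊A⌋₊ ⌊2 * A⌋₊, ∑ b ∈ Finset.Icc 1 ⌊x / A⌋₊, u a * v b * entry c a b| ≤
        x ^ (1 / 2 : ℝ) / Real.log x ^ C

/-- RESIDUAL (mean-square dispersion of the table against completely multiplicative column weights):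
for every completely multiplicative `g : ℕ → ℂ` with `‖g‖ ≤ 1` and every initial segment `b ≤ y`,
`y ≤ x/A`: `∑_{a ∈ (⌊A⌋,⌊2A⌋]} ‖∑_{b ≤ ⌊y⌋} g(b) λ(ab+c)‖² ≤ x·(x/A)/(log x)^C` (trivial bound `≍ x·(x/A)`;
random model `≍ x`). Binary Elliott for the pair `(g, λ)` on the forms `(b, ab+c)`, log-power saving, in
mean square over `≥ x^δ` dilations; implied by the crux; `g = 1, χ`: Bombieri–Vinogradov for `λ`
(theorem); `g = λ`: fixed-shift Chowla in the progressions `0 mod a` on average over `a ∼ A` (open). -/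
def MeanSquareCM : Prop :=
  ∀ c : ℤ, c ≠ 0 → ∀ δ : ℝ, 0 < δ → δ ≤ 1 / 12 → ∀ C : ℝ, 0 < C → ∃ x₀ : ℝ, ∀ x : ℝ, x₀ ≤ x →
    ∀ A : ℝ, x ^ δ ≤ A → A ≤ x ^ (1 / 3 + δ) →
    ∀ g : ℕ → ℂ, (∀ m n : ℕ, g (m * n) = g m * g n) → (∀ n : ℕ, ‖g n‖ ≤ 1) →
    ∀ y : ℝ, y ≤ x / A →
      ∑ a ∈ Finset.Ioc ⌊A⌋₊ ⌊2 * A⌋₊,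
          ‖∑ b ∈ Finset.Icc 1 ⌊y⌋₊, g b * (entry c a b : ℂ)‖ ^ 2 ≤
        x * (x / A) / Real.log x ^ C

/-- RESIDUAL, ONE-POINT PART (registered stub): `MeanSquareCM` for the completely multiplicative
1-bounded weights `g` that are `q`-PERIODIC for some `1 ≤ q ≤ (log x)^K` (constants and Dirichlet
characters of polylogarithmic conductor), for every `K`. Splitting `b` by classes mod `q` turns
`∑_{b ≤ y} g(b)λ(ab+c)` into `≤ q` sums of `λ` over progressions of modulus `aq ≤ 2x^{1/3+δ}(log x)^K
< x^{1/2-ε}`, so this is Bombieri–Vinogradov for `λ` with one (not necessarily coprime) residue and one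
height per modulus — the route's support item `BVLiouville` (stmt-Parity-13324) at scale `3x`, with a
loss `q²·(multiplicity ≤ |c|q) = (log x)^{O(K)}`. Theorem-grade. -/
def MeanSquareCMPeriodic : Prop :=
  ∀ c : ℤ, c ≠ 0 → ∀ δ : ℝ, 0 < δ → δ ≤ 1 / 12 → ∀ C : ℝ, 0 < C → ∀ K : ℝ, 0 < K → ∃ x₀ : ℝ,
    ∀ x : ℝ, x₀ ≤ x → ∀ A : ℝ, x ^ δ ≤ A → A ≤ x ^ (1 / 3 + δ) →
    ∀ g : ℕ → ℂ, (∀ m n : ℕ, g (m * n) = g m * g n) → (∀ n : ℕ, ‖g n‖ ≤ 1) →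
    ∀ q : ℕ, 1 ≤ q → (q : ℝ) ≤ Real.log x ^ K → Function.Periodic g q →
    ∀ y : ℝ, y ≤ x / A →
      ∑ a ∈ Finset.Ioc ⌊A⌋₊ ⌊2 * A⌋₊,
          ‖∑ b ∈ Finset.Icc 1 ⌊y⌋₊, g b * (entry c a b : ℂ)‖ ^ 2 ≤
        x * (x / A) / Real.log x ^ C

/-- RESIDUAL, TWO-POINT PART (registered stub): for some `K` of the prover's choosing (larger `K` =
fewer weights), `MeanSquareCM` for the completely multiplicative 1-bounded weights with NO period
`q ≤ (log x)^K`: `g = λ` (fixed-shift binary Chowla in the progressions `0 mod a`, mean square over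
`a ∼ A`), `g = n^{it}`, characters of conductor `> (log x)^K`, `z^{Ω(n)}`, `𝟙_{smooth}`, generic CM `g`
— binary Elliott for the pair `(g, λ)` with a log-power saving, averaged over `≥ x^δ` dilations of one
form. Open-problem grade (believed: random model `≍ x` against the bound `x·(x/A)/(log x)^C`). -/
def MeanSquareCMAperiodic : Prop :=
  ∀ c : ℤ, c ≠ 0 → ∀ δ : ℝ, 0 < δ → δ ≤ 1 / 12 → ∀ C : ℝ, 0 < C → ∃ K : ℝ, 0 < K ∧ ∃ x₀ : ℝ,
    ∀ x : ℝ, x₀ ≤ x → ∀ A : ℝ, x ^ δ ≤ A → A ≤ x ^ (1 / 3 + δ) →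
    ∀ g : ℕ → ℂ, (∀ m n : ℕ, g (m * n) = g m * g n) → (∀ n : ℕ, ‖g n‖ ≤ 1) →
    (∀ q : ℕ, 1 ≤ q → (q : ℝ) ≤ Real.log x ^ K → ¬ Function.Periodic g q) →
    ∀ y : ℝ, y ≤ x / A →
      ∑ a ∈ Finset.Ioc ⌊A⌋₊ ⌊2 * A⌋₊,
          ‖∑ b ∈ Finset.Icc 1 ⌊y⌋₊, g b * (entry c a b : ℂ)‖ ^ 2 ≤
        x * (x / A) / Real.log x ^ C

/-- COLUMN-PERIODICITY (lead reshape r2): the weight `g` agrees on the columns `[1, ⌊x/A⌋]` with some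
`q`-periodic function, for some `1 ≤ q ≤ (log x)^K`. This — not `Function.Periodic g q` on all of `ℕ`,
which the standing disprover showed to be a VOID proviso (`Negative/TableChowlaAperiodicVacuity`:
any CM `g` becomes aperiodic after a change at one prime outside the columns) — is the property the
Bombieri–Vinogradov argument consumes. -/
def ColPeriodic (x A K : ℝ) (g : ℕ → ℂ) : Prop :=
  ∃ q : ℕ, 1 ≤ q ∧ (q : ℝ) ≤ Real.log x ^ K ∧ ∃ h : ℕ → ℂ, Function.Periodic h q ∧
    ∀ b ∈ Finset.Icc 1 ⌊x / A⌋₊, g b = h b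

/-- RESIDUAL, ONE-POINT PART, REPAIRED CUT (registered stub `stub_periodicCols_of_bv`, from
`BVLiouville`): `MeanSquareCM` for the CM 1-bounded weights that are COLUMN-periodic with a period
`≤ (log x)^K`, for every `K` (constants, `𝟙_{n ≥ 1}`, Dirichlet characters of polylogarithmic conductor,
and anything agreeing with such on the columns). Theorem-grade: Bombieri–Vinogradov for `λ`. -/
def MeanSquareCMPeriodicCols : Prop :=
  ∀ c : ℤ, c ≠ 0 → ∀ δ : ℝ, 0 < δ → δ ≤ 1 / 12 → ∀ C : ℝ, 0 < C → ∀ K : ℝ, 0 < K → ∃ x₀ : ℝ,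
    ∀ x : ℝ, x₀ ≤ x → ∀ A : ℝ, x ^ δ ≤ A → A ≤ x ^ (1 / 3 + δ) →
    ∀ g : ℕ → ℂ, (∀ m n : ℕ, g (m * n) = g m * g n) → (∀ n : ℕ, ‖g n‖ ≤ 1) →
    ColPeriodic x A K g →
    ∀ y : ℝ, y ≤ x / A →
      ∑ a ∈ Finset.Ioc ⌊A⌋₊ ⌊2 * A⌋₊,
          ‖∑ b ∈ Finset.Icc 1 ⌊y⌋₊, g b * (entry c a b : ℂ)‖ ^ 2 ≤
        x * (x / A) / Real.log x ^ C

/-- RESIDUAL, TWO-POINT PART, REPAIRED CUT (registered stub `stub_aperiodicCols`): for some `K` of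
the prover's choosing, `MeanSquareCM` for the CM 1-bounded weights that are NOT column-periodic with
any period `≤ (log x)^K`. Now a genuine restriction of the residual (larger `K` = fewer weights):
`g = λ`, `n^{it}`, characters of conductor `> (log x)^K` and their finite modifications, `z^{Ω(n)}`,
generic CM `g`. Binary Elliott for `(g, λ)` with CM weights, log-power saving, mean square over
`≥ x^δ` dilations — open-problem grade; implied by the crux. (Natural further refinement, not typed
here: cut by pretentious distance `𝔻(g, χ n^{it}; x/A)² ≤ K' log log x` instead.) -/
def MeanSquareCMAperiodicCols : Prop :=
  ∀ c : ℤ, c ≠ 0 → ∀ δ : ℝ, 0 < δ → δ ≤ 1 / 12 → ∀ C : ℝ, 0 < C → ∃ K : ℝ, 0 < K ∧ ∃ x₀ : ℝ,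
    ∀ x : ℝ, x₀ ≤ x → ∀ A : ℝ, x ^ δ ≤ A → A ≤ x ^ (1 / 3 + δ) →
    ∀ g : ℕ → ℂ, (∀ m n : ℕ, g (m * n) = g m * g n) → (∀ n : ℕ, ‖g n‖ ≤ 1) →
    ¬ ColPeriodic x A K g →
    ∀ y : ℝ, y ≤ x / A →
      ∑ a ∈ Finset.Ioc ⌊A⌋₊ ⌊2 * A⌋₊,
          ‖∑ b ∈ Finset.Icc 1 ⌊y⌋₊, g b * (entry c a b : ℂ)‖ ^ 2 ≤
        x * (x / A) / Real.log x ^ C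

/-- THE LEVER (inverse theorem for finite Helson sections of `m ↦ λ(m+c)`, one-sided, `∀ C ∃ C'`):
a near-trivial value of the bilinear form on some pair of `ℓ²`-unit test vectors forces a completely
multiplicative 1-bounded column weight `g` (on some initial segment `b ≤ y ≤ x/A`) whose image under
the table has near-trivial mean square over the rows. -/
def InverseCM : Prop :=
  ∀ c : ℤ, c ≠ 0 → ∀ δ : ℝ, 0 < δ → δ ≤ 1 / 12 → ∀ C : ℝ, 0 < C → ∃ C' : ℝ, 0 < C' ∧ ∃ x₀ : ℝ,
    ∀ x : ℝ, x₀ ≤ x → ∀ A : ℝ, x ^ δ ≤ A → A ≤ x ^ (1 / 3 + δ) →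
    ∀ u v : ℕ → ℝ, (∑ a ∈ Finset.Ioc ⌊A⌋₊ ⌊2 * A⌋₊, u a ^ 2 ≤ 1) →
      (∑ b ∈ Finset.Icc 1 ⌊x / A⌋₊, v b ^ 2 ≤ 1) →
      x ^ (1 / 2 : ℝ) / Real.log x ^ C ≤
        |∑ a ∈ Finset.Ioc ⌊A⌋₊ ⌊2 * A⌋₊, ∑ b ∈ Finset.Icc 1 ⌊x / A⌋₊, u a * v b * entry c a b| →
      ∃ g : ℕ → ℂ, (∀ m n : ℕ, g (m * n) = g m * g n) ∧ (∀ n : ℕ, ‖g n‖ ≤ 1) ∧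
        ∃ y : ℝ, y ≤ x / A ∧
          x * (x / A) / Real.log x ^ C' ≤
            ∑ a ∈ Finset.Ioc ⌊A⌋₊ ⌊2 * A⌋₊,
              ‖∑ b ∈ Finset.Icc 1 ⌊y⌋₊, g b * (entry c a b : ℂ)‖ ^ 2

/-! ## Registered stubs (LEAD RESHAPE r5, 2026-08-16): OPEN `stub_primeCore`, `stub_inverse_compositeCols`,
`stub_residual_compositeCols`; CLOSED `stub_bv`, `stub_periodicCols_of_bv` (import deferred), T1–T3

History. r1 split the plan's `stub_periodic` along its one unproved lean into `stub_bv : BVLiouville`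
and `stub_periodic_of_bv`; wave 1 LANDED both (`stub_bv` p75572 — BVLiouville itself was proved in the
tree, item stmt-Parity-13324 closed; `stub_periodic_of_bv` p77485 + aux p75692) and the calibration of
the aperiodic stub (p74732). Meanwhile the standing disprover (gen 3) proved the plan's periodic /
aperiodic cut VOID (`Negative/TableChowlaAperiodicVacuity`: `MeanSquareCMAperiodic ↔ MeanSquareCM`),
i.e. `stub_aperiodic` was MISSTATED (it was the whole residual). r2 repairs the cut by
COLUMN-periodicity (`ColPeriodic`): registered stubs are now `stub_inverse` (lead, open),
`stub_bv` (closed), `stub_periodicCols_of_bv` (closed by the lead: adapted from the landed r1 proof —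
the BV argument only ever used periodicity and 1-boundedness ON THE COLUMNS) and `stub_aperiodicCols`
(open, genuinely smaller than the residual). Every signature is inlined over Mathlib + route decls.
-/

/-- **STUB `stub_bv` — CLOSED** (theorem-grade; = the route's support item `BVLiouville`,
stmt-Parity-13324, BY NAME — Bombieri–Vinogradov for `λ` at level `x^{1/2-ε}` with one arbitrary
residue and one height per modulus; all ingredients PROVED in tree: BFI Theorem 0(b)
`Literature.NumberTheory.Sieve.BombieriFriedlanderIwaniecTheorem0b_holds`, Siegel–Walfisz for `λ`
`Literature.NumberTheory.LFunctions.SiegelWalfiszMoebius_holds` / `.liouville_progression`, Heath-Brown's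
identity; print carrier vendored as the named fact
`Literature.NumberTheory.Sieve.FouvryTenenbaum2021_thm18_liouville`). When stmt-Parity-13324 is proved the
gate appends `BVLiouville_holds` to the route file and this stub closes by `exact BVLiouville_holds`. -/
theorem stub_bv :
    Summit.Parity.GeneralizedHardyLittlewood.Theses.LiouvilleShiftedTables.BVLiouville :=
  -- CLOSED (wave 1, p75572): landed `Theorems/LiouvilleShiftedTablesTableChowlaBVLiouville.lean`,
  -- itself the tree's `PeelToDrappeau.BVLiouville_proof` (item stmt-Parity-13324 closed 2026-08-16).
  Summit.Parity.GeneralizedHardyLittlewood.Theorems.TableChowla.HelsonKroneckerInverse.stub_bv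

/-- **STUB `stub_periodicCols_of_bv` — CALIBRATION, CLOSED (landed p83535; logically a sub-case of
`stub_residualCM`)** (size L, theorem-grade; lead): the column-periodic residual
`MeanSquareCMPeriodicCols` (inlined) from `BVLiouville`. Proof = the landed r1 proof with `g` replaced
on the columns by the clipped periodic function `h·𝟙_{‖h‖≤1}` (work file
`work/stubs/stub_periodicCols_of_bv.lean`, rc 0, 0 sorry; to land as
`Theorems/LiouvilleShiftedTablesTableChowlaPeriodicColsOfBV.lean`). -/
theorem stub_periodicCols_of_bv :
    Summit.Parity.GeneralizedHardyLittlewood.Theses.LiouvilleShiftedTables.BVLiouville →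
    ∀ c : ℤ, c ≠ 0 → ∀ δ : ℝ, 0 < δ → δ ≤ 1 / 12 → ∀ C : ℝ, 0 < C → ∀ K : ℝ, 0 < K → ∃ x₀ : ℝ,
    ∀ x : ℝ, x₀ ≤ x → ∀ A : ℝ, x ^ δ ≤ A → A ≤ x ^ (1 / 3 + δ) →
    ∀ g : ℕ → ℂ, (∀ m n : ℕ, g (m * n) = g m * g n) → (∀ n : ℕ, ‖g n‖ ≤ 1) →
    (∃ q : ℕ, 1 ≤ q ∧ (q : ℝ) ≤ Real.log x ^ K ∧ ∃ h : ℕ → ℂ, Function.Periodic h q ∧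
        ∀ b ∈ Finset.Icc 1 ⌊x / A⌋₊, g b = h b) →
    ∀ y : ℝ, y ≤ x / A →
      ∑ a ∈ Finset.Ioc ⌊A⌋₊ ⌊2 * A⌋₊,
          ‖∑ b ∈ Finset.Icc 1 ⌊y⌋₊, g b *
            ((ArithmeticFunction.liouville (Int.toNat ((a : ℤ) * b + c)) : ℝ) : ℂ)‖ ^ 2 ≤
        x * (x / A) / Real.log x ^ C := by
  -- CLOSED (p83535); import deferred (farm has not built that module yet)
  sorry


/-- **STUB `stub_primeCore`** (r5, OPEN — THE UNSTRUCTURED CORE, shared by every line): the operator-norm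
bound with ARBITRARY `ℓ²`-unit coefficients for the sub-table (rows `a ∈ (⌊A⌋,⌊2A⌋]`) × (free columns:
primes `p ≤ ⌊x/A⌋` with `p² > ⌊x/A⌋`): `|∑_a ∑_p u_a v_p λ(ap+c)| ≤ √x/(log x)^C`, every `C` — Type II for
`λ(ap+c)` with unstructured coefficients in both variables (trivial bound `≍ √x/√(log x)`). A SUB-TABLE of the
crux (`primeCore_of_tableChowla`); implied by `MeanSquareCM` (T2, landed p89573); no dispersion method applies
(`p` does not factor, `a ≤ x^{5/12}` carries arbitrary coefficients). = `PrimeCore` inlined. -/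
theorem stub_primeCore :
    ∀ c : ℤ, c ≠ 0 → ∀ δ : ℝ, 0 < δ → δ ≤ 1 / 12 → ∀ C : ℝ, 0 < C → ∃ x₀ : ℝ, ∀ x : ℝ, x₀ ≤ x →
      ∀ A : ℝ, x ^ δ ≤ A → A ≤ x ^ (1 / 3 + δ) →
      ∀ u v : ℕ → ℝ, (∑ a ∈ Finset.Ioc ⌊A⌋₊ ⌊2 * A⌋₊, u a ^ 2 ≤ 1) →
        (∑ b ∈ Finset.Icc 1 ⌊x / A⌋₊, v b ^ 2 ≤ 1) →
        |∑ a ∈ Finset.Ioc ⌊A⌋₊ ⌊2 * A⌋₊,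
            ∑ b ∈ (Finset.Icc 1 ⌊x / A⌋₊).filter (fun b => b.Prime ∧ ⌊x / A⌋₊ < b * b),
              u a * v b * (ArithmeticFunction.liouville (Int.toNat ((a : ℤ) * b + c)) : ℝ)| ≤
          x ^ (1 / 2 : ℝ) / Real.log x ^ C := by
  sorry

/-- **STUB `stub_inverse_compositeCols`** (r5, OPEN — the lever on the CONSTRAINED columns): `InverseCM`
with the near-extremal form restricted to the columns `b ≤ ⌊x/A⌋` that are NOT free (composite, `b = 1`, or
prime with `b² ≤ ⌊x/A⌋`) — exactly the columns on which complete multiplicativity constrains the witness.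
Together with T1 (landed) it gives `InverseCM` (`inverseCM_of_primeCols_compositeCols`). Implied by the crux
(vacuously). No mechanism known; the symbol-generic version is false here (planted smooth block). =
`InverseCompositeCols` inlined. -/
theorem stub_inverse_compositeCols :
    ∀ c : ℤ, c ≠ 0 → ∀ δ : ℝ, 0 < δ → δ ≤ 1 / 12 → ∀ C : ℝ, 0 < C → ∃ C' : ℝ, 0 < C' ∧ ∃ x₀ : ℝ,
    ∀ x : ℝ, x₀ ≤ x → ∀ A : ℝ, x ^ δ ≤ A → A ≤ x ^ (1 / 3 + δ) →
    ∀ u v : ℕ → ℝ, (∑ a ∈ Finset.Ioc ⌊A⌋₊ ⌊2 * A⌋₊, u a ^ 2 ≤ 1) →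
      (∑ b ∈ Finset.Icc 1 ⌊x / A⌋₊, v b ^ 2 ≤ 1) →
      x ^ (1 / 2 : ℝ) / Real.log x ^ C ≤
        |∑ a ∈ Finset.Ioc ⌊A⌋₊ ⌊2 * A⌋₊,
          ∑ b ∈ (Finset.Icc 1 ⌊x / A⌋₊).filter (fun b => ¬ (b.Prime ∧ ⌊x / A⌋₊ < b * b)),
            u a * v b * (ArithmeticFunction.liouville (Int.toNat ((a : ℤ) * b + c)) : ℝ)| →
      ∃ g : ℕ → ℂ, (∀ m n : ℕ, g (m * n) = g m * g n) ∧ (∀ n : ℕ, ‖g n‖ ≤ 1) ∧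
        ∃ y : ℝ, y ≤ x / A ∧
          x * (x / A) / Real.log x ^ C' ≤
            ∑ a ∈ Finset.Ioc ⌊A⌋₊ ⌊2 * A⌋₊,
              ‖∑ b ∈ Finset.Icc 1 ⌊y⌋₊, g b *
                ((ArithmeticFunction.liouville (Int.toNat ((a : ℤ) * b + c)) : ℝ) : ℂ)‖ ^ 2 := by
  sorry

/-- **STUB `stub_residual_compositeCols`** (r5, OPEN — the residual on the CONSTRAINED columns):
`MeanSquareCM` with the column sum restricted to the non-free columns `b ≤ ⌊y⌋` — the part of the residual
where "completely multiplicative" is a genuine restriction (`g = λ`: dilation-averaged fixed-shift binary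
Chowla over the integers with a prime factor `≤ √(x/A)`; `g = χ n^{it}`: landed calibrations). Together with
`stub_primeCore` it gives `MeanSquareCM` (`meanSquareCM_of_primeCore_compositeCols`). Implied by the crux
(`Negative.meanSquareBounded_iff`). = `ResidualCompositeCols` inlined. -/
theorem stub_residual_compositeCols :
    ∀ c : ℤ, c ≠ 0 → ∀ δ : ℝ, 0 < δ → δ ≤ 1 / 12 → ∀ C : ℝ, 0 < C → ∃ x₀ : ℝ, ∀ x : ℝ, x₀ ≤ x →
    ∀ A : ℝ, x ^ δ ≤ A → A ≤ x ^ (1 / 3 + δ) →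
    ∀ g : ℕ → ℂ, (∀ m n : ℕ, g (m * n) = g m * g n) → (∀ n : ℕ, ‖g n‖ ≤ 1) →
    ∀ y : ℝ, y ≤ x / A →
      ∑ a ∈ Finset.Ioc ⌊A⌋₊ ⌊2 * A⌋₊,
          ‖∑ b ∈ (Finset.Icc 1 ⌊y⌋₊).filter (fun b => ¬ (b.Prime ∧ ⌊x / A⌋₊ < b * b)),
              g b * ((ArithmeticFunction.liouville (Int.toNat ((a : ℤ) * b + c)) : ℝ) : ℂ)‖ ^ 2 ≤
        x * (x / A) / Real.log x ^ C := by
  sorry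

/-! ## r4 calibration stubs (registered; theorem-grade; they do not enter `TableChowla_of`) -/

/-- **STUB `stub_inverse_primeCols` — CLOSED (landed p87332)** (r4 calibration T1, theorem-grade, size M): THE LEVER ON THE PRIME
COLUMNS. If the bilinear form restricted to the prime columns `p ∈ [1, ⌊x/A⌋]` with `p² > ⌊x/A⌋` is
near-extremal, `|∑_a ∑_p u_a v_p λ(ap+c)| ≥ √x/(log x)^C` for `ℓ²`-unit `u, v`, then a completely
multiplicative 1-bounded column witness exists (`C' = 4C+1`, `y = x/A`): delocalise `v` on those primes
(`Negative.delocalise`: truncate at `τ = 2(log x)^C√rows/√x`, rescale by `1/τ`) and EXTEND the resulting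
1-bounded weight `t` to a completely multiplicative `g` by `g(p) := t_p` on those primes, `g(p) := 0` on every
other prime — on `[1, ⌊x/A⌋]` such a `g` equals `t` on the large primes, `1` at `b = 1` and `0` elsewhere
(every other `b ≤ ⌊x/A⌋` has a prime factor `p` with `p² ≤ ⌊x/A⌋`). No hypothesis on `c`. Reading: the lever
is a theorem exactly where complete multiplicativity is no constraint. -/
theorem stub_inverse_primeCols :
    ∀ c : ℤ, ∀ δ : ℝ, 0 < δ → δ ≤ 1 / 12 → ∀ C : ℝ, 0 < C → ∃ C' : ℝ, 0 < C' ∧ ∃ x₀ : ℝ,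
    ∀ x : ℝ, x₀ ≤ x → ∀ A : ℝ, x ^ δ ≤ A → A ≤ x ^ (1 / 3 + δ) →
    ∀ u v : ℕ → ℝ, (∑ a ∈ Finset.Ioc ⌊A⌋₊ ⌊2 * A⌋₊, u a ^ 2 ≤ 1) →
      (∑ b ∈ Finset.Icc 1 ⌊x / A⌋₊, v b ^ 2 ≤ 1) →
      x ^ (1 / 2 : ℝ) / Real.log x ^ C ≤
        |∑ a ∈ Finset.Ioc ⌊A⌋₊ ⌊2 * A⌋₊,
          ∑ b ∈ (Finset.Icc 1 ⌊x / A⌋₊).filter (fun b => b.Prime ∧ ⌊x / A⌋₊ < b * b),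
            u a * v b * (ArithmeticFunction.liouville (Int.toNat ((a : ℤ) * b + c)) : ℝ)| →
      ∃ g : ℕ → ℂ, (∀ m n : ℕ, g (m * n) = g m * g n) ∧ (∀ n : ℕ, ‖g n‖ ≤ 1) ∧
        ∃ y : ℝ, y ≤ x / A ∧
          x * (x / A) / Real.log x ^ C' ≤
            ∑ a ∈ Finset.Ioc ⌊A⌋₊ ⌊2 * A⌋₊,
              ‖∑ b ∈ Finset.Icc 1 ⌊y⌋₊, g b *
                ((ArithmeticFunction.liouville (Int.toNat ((a : ℤ) * b + c)) : ℝ) : ℂ)‖ ^ 2 :=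
  -- CLOSED (p87332): landed `Theorems/LiouvilleShiftedTablesTableChowlaStubInversePrimeCols.lean`.
  Summit.Parity.GeneralizedHardyLittlewood.Theorems.TableChowla.HelsonKroneckerInverse.stub_inverse_primeCols

/-- **STUB `stub_residual_primeCore` — CLOSED (landed p89573)** (r4 calibration T2, theorem-grade given T1, size S): THE
RESIDUAL CONTAINS THE PRIME-COLUMN CORE. `MeanSquareCM` (inlined, as hypothesis) implies the operator-norm
bound with ARBITRARY `ℓ²`-unit coefficients for the sub-table (rows `a ∈ (⌊A⌋,⌊2A⌋]`) × (prime columns `p ≤ ⌊x/A⌋`,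
`p² > ⌊x/A⌋`): `|∑_a ∑_p u_a v_p λ(ap+c)| ≤ √x/(log x)^C`, every `C` — Type II for `λ(ap+c)` with unstructured
coefficients on both variables (trivial bound `≍ √x/√(log x)`; no dispersion method applies: `p` does not
factor and `a ≤ x^{5/12}` is arbitrary). Proof: if the form were large, T1 gives a CM witness contradicting the
residual at level `C'+1`. So the "structured" residual is unstructured on the columns where CM weights are
free — the one-sided cut does NOT avoid the arbitrary-coefficient core (cf. Gen-2 Lemma A, two-sided). -/
theorem stub_residual_primeCore :
    (∀ c : ℤ, c ≠ 0 → ∀ δ : ℝ, 0 < δ → δ ≤ 1 / 12 → ∀ C : ℝ, 0 < C → ∃ x₀ : ℝ, ∀ x : ℝ, x₀ ≤ x →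
      ∀ A : ℝ, x ^ δ ≤ A → A ≤ x ^ (1 / 3 + δ) →
      ∀ g : ℕ → ℂ, (∀ m n : ℕ, g (m * n) = g m * g n) → (∀ n : ℕ, ‖g n‖ ≤ 1) →
      ∀ y : ℝ, y ≤ x / A →
        ∑ a ∈ Finset.Ioc ⌊A⌋₊ ⌊2 * A⌋₊,
            ‖∑ b ∈ Finset.Icc 1 ⌊y⌋₊, g b *
              ((ArithmeticFunction.liouville (Int.toNat ((a : ℤ) * b + c)) : ℝ) : ℂ)‖ ^ 2 ≤
          x * (x / A) / Real.log x ^ C) →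
    ∀ c : ℤ, c ≠ 0 → ∀ δ : ℝ, 0 < δ → δ ≤ 1 / 12 → ∀ C : ℝ, 0 < C → ∃ x₀ : ℝ, ∀ x : ℝ, x₀ ≤ x →
      ∀ A : ℝ, x ^ δ ≤ A → A ≤ x ^ (1 / 3 + δ) →
      ∀ u v : ℕ → ℝ, (∑ a ∈ Finset.Ioc ⌊A⌋₊ ⌊2 * A⌋₊, u a ^ 2 ≤ 1) →
        (∑ b ∈ Finset.Icc 1 ⌊x / A⌋₊, v b ^ 2 ≤ 1) →
        |∑ a ∈ Finset.Ioc ⌊A⌋₊ ⌊2 * A⌋₊,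
            ∑ b ∈ (Finset.Icc 1 ⌊x / A⌋₊).filter (fun b => b.Prime ∧ ⌊x / A⌋₊ < b * b),
              u a * v b * (ArithmeticFunction.liouville (Int.toNat ((a : ℤ) * b + c)) : ℝ)| ≤
          x ^ (1 / 2 : ℝ) / Real.log x ^ C :=
  -- CLOSED (p89573): landed `Theorems/LiouvilleShiftedTablesTableChowlaStubResidualPrimeCore.lean`.
  Summit.Parity.GeneralizedHardyLittlewood.Theorems.TableChowla.HelsonKroneckerInverse.stub_residual_primeCore

/-- **STUB `stub_archTwist_periodicCols` — CLOSED (landed p88785)** (r4 calibration T3, theorem-grade, size M–L): THE RESIDUAL ON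
ARCHIMEDEAN TWISTS OF PERIODIC WEIGHTS. For column weights that agree on `[1, ⌊x/A⌋]` with `h·w`, `h`
`q`-periodic and 1-bounded (`1 ≤ q ≤ (log x)^K`), `w` 1-bounded with total variation `∑_b ‖w(b+1) − w(b)‖ ≤
(log x)^K` on the columns (e.g. `w(b) = b^{it}`, `|t| log x ≤ (log x)^K`; so `g = χ(n)n^{it}` with
`cond χ ≤ (log x)^K`), the mean square over the rows is `≤ x(x/A)/(log x)^C`. Proof: Abel summation in `b`
against `w`, then Cauchy–Schwarz with the weights `‖Δw‖`, reduces to the column-periodic bound for the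
1-bounded periodic weight `h` at exponent `C + 2K + 2`, at every height `u ≤ ⌊y⌋` (the landed r2 proof of
`stub_periodicCols_of_bv` uses only 1-boundedness and periodicity on the columns, never complete
multiplicativity; `BVLiouville` is the landed `stub_bv`). No multiplicativity hypothesis on `g`. Reading: all
major-arc pretentious directions `χ n^{it}`, `|t| ≤ (log x)^{K-1}`, are theorems; the residual's open content
is the class of weights far from every such direction. -/
theorem stub_archTwist_periodicCols :
    ∀ c : ℤ, c ≠ 0 → ∀ δ : ℝ, 0 < δ → δ ≤ 1 / 12 → ∀ C : ℝ, 0 < C → ∀ K : ℝ, 0 < K → ∃ x₀ : ℝ,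
    ∀ x : ℝ, x₀ ≤ x → ∀ A : ℝ, x ^ δ ≤ A → A ≤ x ^ (1 / 3 + δ) →
    ∀ g : ℕ → ℂ,
    (∃ q : ℕ, 1 ≤ q ∧ (q : ℝ) ≤ Real.log x ^ K ∧ ∃ h : ℕ → ℂ, Function.Periodic h q ∧
      (∀ n : ℕ, ‖h n‖ ≤ 1) ∧ ∃ w : ℕ → ℂ, (∀ n : ℕ, ‖w n‖ ≤ 1) ∧
        (∑ b ∈ Finset.Icc 1 ⌊x / A⌋₊, ‖w (b + 1) - w b‖ ≤ Real.log x ^ K) ∧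
        ∀ b ∈ Finset.Icc 1 ⌊x / A⌋₊, g b = h b * w b) →
    ∀ y : ℝ, y ≤ x / A →
      ∑ a ∈ Finset.Ioc ⌊A⌋₊ ⌊2 * A⌋₊,
          ‖∑ b ∈ Finset.Icc 1 ⌊y⌋₊, g b *
            ((ArithmeticFunction.liouville (Int.toNat ((a : ℤ) * b + c)) : ℝ) : ℂ)‖ ^ 2 ≤
        x * (x / A) / Real.log x ^ C :=
  -- CLOSED (p88785): landed `Theorems/LiouvilleShiftedTablesTableChowlaStubArchTwistPeriodicCols.lean`.
  Summit.Parity.GeneralizedHardyLittlewood.Theorems.TableChowla.HelsonKroneckerInverse.stub_archTwist_periodicCols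

/-! ## The named statements from the stubs (definitional; no `sorry` of their own) -/

/-- The column-periodic residual, DERIVED: `stub_periodicCols_of_bv` applied to `stub_bv`. -/
theorem meanSquareCMPeriodicCols_holds : MeanSquareCMPeriodicCols :=
  stub_periodicCols_of_bv stub_bv

/-- For the record (r1, now logically redundant but LANDED): the plan's `MeanSquareCMPeriodic` is the
special case `h = g` of the column-periodic branch. -/
theorem meanSquareCMPeriodic_of_cols (hP : MeanSquareCMPeriodicCols) : MeanSquareCMPeriodic := by
  intro c hc δ hδ hδ' C hC K hK
  obtain ⟨x₀, h⟩ := hP c hc δ hδ hδ' C hC K hK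
  exact ⟨x₀, fun x hx A hA hA' g hgm hgb q hq1 hqK hqp y hy =>
    h x hx A hA hA' g hgm hgb ⟨q, hq1, hqK, g, hqp, fun _ _ => rfl⟩ y hy⟩

/-! ## The transfer `OperatorNormForm → TableChowla` (real proof; was the card's stub
`tableChowla_of_operatorNormForm`, "provable now" — proved here, so it is NOT a registered stub) -/

section Transfer

open Finset
open Summit.Parity.GeneralizedHardyLittlewood.Theorems.TableChowla

/-- Finite linear algebra `tr (M Mᵀ)² = ∑_a ‖M (Mᵀ e_a)‖² ≤ ‖M‖_op² · ‖M‖_F²`: an operator-norm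
bound `K` for the bilinear form on `ℓ²`-unit test vectors bounds the fourth moment by `K²` times the
sum of the squared entries. -/
theorem moment_le_of_opNorm (e : ℕ → ℕ → ℝ) (R S : Finset ℕ) {K : ℝ}
    (hop : ∀ u v : ℕ → ℝ, ∑ a ∈ R, u a ^ 2 ≤ 1 → ∑ b ∈ S, v b ^ 2 ≤ 1 →
      |∑ a ∈ R, ∑ b ∈ S, u a * v b * e a b| ≤ K) :
    ∑ a ∈ R, ∑ a' ∈ R, (∑ b ∈ S, e a b * e a' b) ^ 2 ≤ K ^ 2 * ∑ a ∈ R, ∑ b ∈ S, e a b ^ 2 := by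
  rw [mul_sum]
  refine sum_le_sum fun a _ => ?_
  -- `I a' = (M w)_{a'}` for the column-weight vector `w = row a`; `N = ‖M w‖²`, `W = ‖w‖²`
  set I : ℕ → ℝ := fun a' => ∑ b ∈ S, e a b * e a' b with hI
  set N : ℝ := ∑ a' ∈ R, I a' ^ 2 with hN
  set W : ℝ := ∑ b ∈ S, e a b ^ 2 with hW
  have hN0 : 0 ≤ N := sum_nonneg fun _ _ => sq_nonneg _
  have hW0 : 0 ≤ W := sum_nonneg fun _ _ => sq_nonneg _
  show N ≤ K ^ 2 * W
  by_cases hWz : W = 0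
  · -- the row vanishes on `S`, hence so does `M w`
    have hw0 : ∀ b ∈ S, e a b = 0 := by
      intro b hb
      have hsq : e a b ^ 2 = 0 :=
        (sum_eq_zero_iff_of_nonneg (fun b _ => sq_nonneg (e a b))).mp hWz b hb
      exact pow_eq_zero_iff (two_ne_zero) |>.mp hsq
    have hI0 : ∀ a' ∈ R, I a' = 0 := by
      intro a' _
      rw [hI]
      exact sum_eq_zero fun b hb => by rw [hw0 b hb, zero_mul]
    have hN' : N = 0 := sum_eq_zero fun a' ha' => by rw [hI0 a' ha']; ring
    rw [hN', hWz, mul_zero]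
  by_cases hNz : N = 0
  · rw [hNz]; positivity
  have hWpos : 0 < W := lt_of_le_of_ne hW0 (Ne.symm hWz)
  have hNpos : 0 < N := lt_of_le_of_ne hN0 (Ne.symm hNz)
  have hsW : Real.sqrt W ^ 2 = W := Real.sq_sqrt hW0
  have hsN : Real.sqrt N ^ 2 = N := Real.sq_sqrt hN0
  have hsWpos : 0 < Real.sqrt W := Real.sqrt_pos.mpr hWpos
  have hsNpos : 0 < Real.sqrt N := Real.sqrt_pos.mpr hNpos
  -- the unit test vectors `v = w/‖w‖`, `u = M w/‖M w‖`
  have hv1 : ∑ b ∈ S, (e a b / Real.sqrt W) ^ 2 ≤ 1 := by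
    simp_rw [div_pow]
    rw [← sum_div, hsW, div_self hWz]
  have hu1 : ∑ a' ∈ R, (I a' / Real.sqrt N) ^ 2 ≤ 1 := by
    simp_rw [div_pow]
    rw [← sum_div, hsN, div_self hNz]
  have hIa : ∀ a', ∑ b ∈ S, e a b * e a' b = I a' := fun a' => by simp only [hI]
  have hform : ∑ a' ∈ R, ∑ b ∈ S, (I a' / Real.sqrt N) * (e a b / Real.sqrt W) * e a' b =
      Real.sqrt N / Real.sqrt W := by
    have hstep : ∀ a', ∑ b ∈ S, (I a' / Real.sqrt N) * (e a b / Real.sqrt W) * e a' b =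
        I a' ^ 2 / (Real.sqrt N * Real.sqrt W) := by
      intro a'
      calc ∑ b ∈ S, (I a' / Real.sqrt N) * (e a b / Real.sqrt W) * e a' b
          = (I a' / (Real.sqrt N * Real.sqrt W)) * ∑ b ∈ S, e a b * e a' b := by
            rw [mul_sum]
            refine sum_congr rfl fun b _ => ?_
            ring
        _ = I a' ^ 2 / (Real.sqrt N * Real.sqrt W) := by rw [hIa]; ring
    simp_rw [hstep]
    rw [← sum_div, ← hN]
    have key : ∀ s : ℝ, 0 < s → s ^ 2 = N → N / (s * Real.sqrt W) = s / Real.sqrt W := by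
      intro s hs hs2
      rw [← hs2, sq, mul_div_mul_left _ _ hs.ne']
    exact key _ hsNpos hsN
  have hb := hop (fun a' => I a' / Real.sqrt N) (fun b => e a b / Real.sqrt W) hu1 hv1
  rw [hform, abs_of_nonneg (div_nonneg hsNpos.le hsWpos.le), div_le_iff₀ hsWpos] at hb
  calc N = Real.sqrt N ^ 2 := hsN.symm
    _ ≤ (K * Real.sqrt W) ^ 2 := pow_le_pow_left₀ hsNpos.le hb 2
    _ = K ^ 2 * W := by rw [mul_pow, hsW]

/-- THE TRANSFER (the card's `tableChowla_of_operatorNormForm`, proved; stated here with the landed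
read-back form `Negative.TableChowlaFor Negative.lam`, which is the crux by `Negative.tableChowla_iff :
TableChowla ↔ TableChowlaFor lam := Iff.rfl`, so that `TableChowla_of` below is the file's FIRST
theorem concluding the crux decl by name; the crux-named form is `operatorNormForm_iff_tableChowla`
below). With `K = √x/(log x)^{C+1}`: `T ≤ K²·(rows·cols) ≤ 2x²/(log x)^{2C+2} ≤
x²/(log x)^C` once `log x ≥ 2` (window bookkeeping `rows·cols ≤ 2x` and the eventuality are the landed
`Negative.rows_mul_cols_le_window`, `Negative.eventually_log_rpow_le`). -/
theorem tableChowlaFor_of_operatorNormForm (hop : OperatorNormForm) :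
    Negative.TableChowlaFor Negative.lam := by
  intro c hc δ hδ hδ' C hC
  obtain ⟨x₁, h1⟩ := hop c hc δ hδ hδ' (C + 1) (by linarith)
  obtain ⟨X, hX⟩ := Negative.eventually_log_rpow_le hδ C
  refine ⟨max (max x₁ X) 1, ?_⟩
  intro x hx A hA hA'
  have hx₁ : x₁ ≤ x := le_trans (le_trans (le_max_left _ _) (le_max_left _ _)) hx
  have hxX : X ≤ x := le_trans (le_trans (le_max_right _ _) (le_max_left _ _)) hx
  have hx1 : (1 : ℝ) ≤ x := le_trans (le_max_right _ _) hx
  have hx0 : (0 : ℝ) ≤ x := by linarith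
  have hlog2 : 2 ≤ Real.log x := (hX x hxX).2
  have hL0 : 0 ≤ Real.log x := by linarith
  have hLpos : 0 < Real.log x := by linarith
  have hmom := moment_le_of_opNorm (entry c) (Ioc ⌊A⌋₊ ⌊2 * A⌋₊) (Icc 1 ⌊x / A⌋₊)
    (h1 x hx₁ A hA hA')
  -- `∑_{a,b} λ(ab+c)² ≤ rows·cols ≤ 2x`
  have hE : ∑ a ∈ Ioc ⌊A⌋₊ ⌊2 * A⌋₊, ∑ b ∈ Icc 1 ⌊x / A⌋₊, entry c a b ^ 2 ≤ 2 * x := by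
    calc ∑ a ∈ Ioc ⌊A⌋₊ ⌊2 * A⌋₊, ∑ b ∈ Icc 1 ⌊x / A⌋₊, entry c a b ^ 2
        ≤ ∑ _a ∈ Ioc ⌊A⌋₊ ⌊2 * A⌋₊, ∑ _b ∈ Icc 1 ⌊x / A⌋₊, (1 : ℝ) :=
          sum_le_sum fun a _ => sum_le_sum fun b _ => Negative.lam_sq_le_one _
      _ = ((⌊2 * A⌋₊ - ⌊A⌋₊ : ℕ) : ℝ) * (⌊x / A⌋₊ : ℝ) := by
          simp only [sum_const, nsmul_eq_mul, mul_one, Nat.card_Ioc, Nat.card_Icc,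
            Nat.add_sub_cancel]
      _ ≤ 2 * x := (Negative.rows_mul_cols_le_window hx1 hδ.le (by linarith) hA hA').1
  have hhalf : (x ^ (1 / 2 : ℝ)) ^ 2 = x := by
    rw [← Real.rpow_natCast, ← Real.rpow_mul hx0]
    norm_num
  have hLC1 : 1 ≤ Real.log x ^ C := Real.one_le_rpow (by linarith) hC.le
  have hLC0 : 0 ≤ Real.log x ^ C := by linarith
  have hsucc : Real.log x ^ (C + 1) = Real.log x ^ C * Real.log x :=
    Real.rpow_add_one hLpos.ne' C
  show Negative.moment Negative.lam c x A ≤ x ^ 2 / Real.log x ^ C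
  unfold Negative.moment Negative.momentN Negative.rowCorr
  calc _ ≤ (x ^ (1 / 2 : ℝ) / Real.log x ^ (C + 1)) ^ 2 *
          ∑ a ∈ Ioc ⌊A⌋₊ ⌊2 * A⌋₊, ∑ b ∈ Icc 1 ⌊x / A⌋₊, entry c a b ^ 2 := hmom
    _ ≤ (x ^ (1 / 2 : ℝ) / Real.log x ^ (C + 1)) ^ 2 * (2 * x) :=
        mul_le_mul_of_nonneg_left hE (sq_nonneg _)
    _ = 2 * x ^ 2 / (Real.log x ^ C * Real.log x) ^ 2 := by
        rw [div_pow, hhalf, hsucc]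
        ring
    _ ≤ x ^ 2 / Real.log x ^ C := by
        rw [div_le_div_iff₀ (by positivity) (by positivity)]
        -- `2 x² L^C ≤ x² (L^C L)²` since `L^C ≥ 1`, `L ≥ 2`
        have hx2 : 0 ≤ x ^ 2 * Real.log x ^ C := mul_nonneg (sq_nonneg _) hLC0
        have hL2 : 4 ≤ Real.log x ^ 2 := by nlinarith
        calc 2 * x ^ 2 * Real.log x ^ C ≤ x ^ 2 * Real.log x ^ C * (1 * 4) := by nlinarith
          _ ≤ x ^ 2 * Real.log x ^ C * (Real.log x ^ C * Real.log x ^ 2) := by gcongr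
          _ = x ^ 2 * (Real.log x ^ C * Real.log x) ^ 2 := by ring

end Transfer

/-! ## Composition (real proofs, no `sorry`) -/

/-- REPAIRED REASSEMBLY (r2): excluded middle on "`g` is column-periodic with a period `≤ (log x)^K`"
(the `K` supplied by the aperiodic half) gives the full residual. -/
theorem meanSquareCM_of_periodicCols_aperiodicCols (hP : MeanSquareCMPeriodicCols)
    (hA : MeanSquareCMAperiodicCols) : MeanSquareCM := by
  intro c hc δ hδ hδ' C hC
  obtain ⟨K, hK, x₂, h2⟩ := hA c hc δ hδ hδ' C hC
  obtain ⟨x₁, h1⟩ := hP c hc δ hδ hδ' C hC K hK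
  refine ⟨max x₁ x₂, ?_⟩
  intro x hx A hAlo hAhi g hgm hgb y hy
  have hx₁ : x₁ ≤ x := le_trans (le_max_left _ _) hx
  have hx₂ : x₂ ≤ x := le_trans (le_max_right _ _) hx
  by_cases hper : ColPeriodic x A K g
  · exact h1 x hx₁ A hAlo hAhi g hgm hgb hper y hy
  · exact h2 x hx₂ A hAlo hAhi g hgm hgb hper y hy

/-- Excluded middle on "`g` has a period `q ≤ (log x)^K`" (with the `K` supplied by the aperiodic
half) reassembles the full residual. -/
theorem meanSquareCM_of_periodic_aperiodic (hP : MeanSquareCMPeriodic)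
    (hA : MeanSquareCMAperiodic) : MeanSquareCM := by
  intro c hc δ hδ hδ' C hC
  obtain ⟨K, hK, x₂, h2⟩ := hA c hc δ hδ hδ' C hC
  obtain ⟨x₁, h1⟩ := hP c hc δ hδ hδ' C hC K hK
  refine ⟨max x₁ x₂, ?_⟩
  intro x hx A hAlo hAhi g hgm hgb y hy
  have hx₁ : x₁ ≤ x := le_trans (le_max_left _ _) hx
  have hx₂ : x₂ ≤ x := le_trans (le_max_right _ _) hx
  by_cases hper : ∃ q : ℕ, 1 ≤ q ∧ (q : ℝ) ≤ Real.log x ^ K ∧ Function.Periodic g q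
  · obtain ⟨q, hq1, hqK, hqp⟩ := hper
    exact h1 x hx₁ A hAlo hAhi g hgm hgb q hq1 hqK hqp y hy
  · exact h2 x hx₂ A hAlo hAhi g hgm hgb (fun q hq1 hqK hqp => hper ⟨q, hq1, hqK, hqp⟩) y hy

/-- The dichotomy closes: the inverse theorem and the residual are incompatible with a near-extremal
pair of test vectors, so the operator-norm form holds. Pure logic plus `(log x)^{C'} < (log x)^{C'+1}`
for `x ≥ 3`. -/
theorem operatorNormForm_of_inverse_msed (hI : InverseCM) (hM : MeanSquareCM) :
    OperatorNormForm := by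
  intro c hc δ hδ hδ' C hC
  obtain ⟨C', hC', x₁, h1⟩ := hI c hc δ hδ hδ' C hC
  obtain ⟨x₂, h2⟩ := hM c hc δ hδ hδ' (C' + 1) (by linarith)
  refine ⟨max (max x₁ x₂) 3, ?_⟩
  intro x hx A hA hA' u v hu hv
  have hx₁ : x₁ ≤ x := le_trans (le_trans (le_max_left _ _) (le_max_left _ _)) hx
  have hx₂ : x₂ ≤ x := le_trans (le_trans (le_max_right _ _) (le_max_left _ _)) hx
  have hx3 : (3 : ℝ) ≤ x := le_trans (le_max_right _ _) hx
  by_contra hlt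
  push Not at hlt
  obtain ⟨g, hgm, hgb, y, hy, hbig⟩ := h1 x hx₁ A hA hA' u v hu hv hlt.le
  have hsmall := h2 x hx₂ A hA hA' g hgm hgb y hy
  have hxpos : 0 < x := by linarith
  have hApos : 0 < A := lt_of_lt_of_le (Real.rpow_pos_of_pos hxpos δ) hA
  have hnum : 0 < x * (x / A) := mul_pos hxpos (div_pos hxpos hApos)
  have hlog : 1 < Real.log x := by
    have he : Real.exp 1 < x :=
      lt_of_lt_of_le (lt_trans Real.exp_one_lt_d9 (by norm_num)) hx3
    exact (Real.lt_log_iff_exp_lt hxpos).2 he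
  have hLpos : 0 < Real.log x := by linarith
  have hpow : Real.log x ^ C' < Real.log x ^ (C' + 1) :=
    Real.rpow_lt_rpow_of_exponent_lt hlog (by linarith)
  have hpowpos : 0 < Real.log x ^ C' := Real.rpow_pos_of_pos hLpos C'
  have hlt' : x * (x / A) / Real.log x ^ (C' + 1) < x * (x / A) / Real.log x ^ C' :=
    div_lt_div_of_pos_left hnum hpowpos hpow
  linarith

/-- COMPOSITION in hypothetical (pure-logic) form: the three stub STATEMENTS imply the crux, stated on the
landed read-back form `Negative.TableChowlaFor Negative.lam` (= the crux by `Negative.tableChowla_iff`, an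
`Iff.rfl`), so that `TableChowla_of` below is the file's UNIQUE theorem concluding the crux decl by name
(the skeleton audit takes the first such theorem and admits no untagged `Prop` hypotheses). -/
theorem tableChowlaFor_of_stubs :
    InverseCM → MeanSquareCM →
      Summit.Parity.GeneralizedHardyLittlewood.Theorems.TableChowla.Negative.TableChowlaFor
        Summit.Parity.GeneralizedHardyLittlewood.Theorems.TableChowla.Negative.lam :=
  fun hI hM => tableChowlaFor_of_operatorNormForm (operatorNormForm_of_inverse_msed hI hM)



/-! ## r5 ANATOMY ALONG THE FREE COLUMNS (lead `prover-line-stmt-Parity-14270-1`, 2026-08-16)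

Let `S = S(x,A) := {b ∈ [1, ⌊x/A⌋] : b prime, b² > ⌊x/A⌋}` be the FREE columns — exactly the columns on which
a completely multiplicative weight is unconstrained (r4 calibrations T1 `stub_inverse_primeCols`, T2
`stub_residual_primeCore`, both landed). The two open r3/r4 stubs are RE-CUT along `S`:
* `InverseCM ⟸ T1 ∧ stub_inverse_compositeCols` (`inverseCM_of_primeCols_compositeCols`: a near-extremal
  form is near-extremal on `S` or on its complement, at the cost `C ↦ C + 1`);
* `MeanSquareCM ⟸ stub_primeCore ∧ stub_residual_compositeCols` (`meanSquareCM_of_primeCore_compositeCols`: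
  split the column sum at `S`; on `S` an operator-norm bound with ARBITRARY coefficients controls every
  1-bounded weight, `sq_form_le_of_opNorm`, real and imaginary parts separately).
All three new stubs follow from the crux (`primeCore_of_tableChowla`, `inverseCompositeCols_of_tableChowla`,
`residualCompositeCols_of_tableChowla`), so together with `TableChowla_of` the anatomy is EXACT:
`tableChowla_iff_anatomy : TableChowla ↔ PrimeCore ∧ InverseCompositeCols ∧ ResidualCompositeCols`.
Reading. `PrimeCore` = Type II for `λ(ap+c)` with UNSTRUCTURED `ℓ²` coefficients on (rows `a ∼ A`) × (prime
columns `p`, `p² > ⌊x/A⌋`), every log-power saving: a sub-table of the crux, common to every line, no method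
known (the column variable does not factor, the row variable is arbitrary). The other two pieces are the
Helson split CONFINED TO THE CONSTRAINED COLUMNS, where "completely multiplicative" is a genuine restriction
for the residual and a genuine demand for the lever — and where no mechanism for the lever is known (its
symbol-generic version is false there: planted smooth block, `Disproof.lean` cycle-3 docblock). -/

section Anatomy

open Finset
open Summit.Parity.GeneralizedHardyLittlewood.Theorems.TableChowla

/-- THE UNSTRUCTURED CORE (registered stub `stub_primeCore`): the operator-norm bound with arbitrary
`ℓ²`-unit coefficients for the sub-table (rows) × (free columns). Implied by the crux (it is a sub-table:
`primeCore_of_tableChowla`); implied by `MeanSquareCM` (T2, landed p89573). -/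
def PrimeCore : Prop :=
  ∀ c : ℤ, c ≠ 0 → ∀ δ : ℝ, 0 < δ → δ ≤ 1 / 12 → ∀ C : ℝ, 0 < C → ∃ x₀ : ℝ, ∀ x : ℝ, x₀ ≤ x →
    ∀ A : ℝ, x ^ δ ≤ A → A ≤ x ^ (1 / 3 + δ) →
    ∀ u v : ℕ → ℝ, (∑ a ∈ Finset.Ioc ⌊A⌋₊ ⌊2 * A⌋₊, u a ^ 2 ≤ 1) →
      (∑ b ∈ Finset.Icc 1 ⌊x / A⌋₊, v b ^ 2 ≤ 1) →
      |∑ a ∈ Finset.Ioc ⌊A⌋₊ ⌊2 * A⌋₊,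
          ∑ b ∈ (Finset.Icc 1 ⌊x / A⌋₊).filter (fun b => b.Prime ∧ ⌊x / A⌋₊ < b * b),
            u a * v b * entry c a b| ≤
        x ^ (1 / 2 : ℝ) / Real.log x ^ C

/-- THE LEVER ON THE CONSTRAINED COLUMNS (registered stub `stub_inverse_compositeCols`): `InverseCM` with
the near-extremal form restricted to the complement of the free columns. -/
def InverseCompositeCols : Prop :=
  ∀ c : ℤ, c ≠ 0 → ∀ δ : ℝ, 0 < δ → δ ≤ 1 / 12 → ∀ C : ℝ, 0 < C → ∃ C' : ℝ, 0 < C' ∧ ∃ x₀ : ℝ,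
    ∀ x : ℝ, x₀ ≤ x → ∀ A : ℝ, x ^ δ ≤ A → A ≤ x ^ (1 / 3 + δ) →
    ∀ u v : ℕ → ℝ, (∑ a ∈ Finset.Ioc ⌊A⌋₊ ⌊2 * A⌋₊, u a ^ 2 ≤ 1) →
      (∑ b ∈ Finset.Icc 1 ⌊x / A⌋₊, v b ^ 2 ≤ 1) →
      x ^ (1 / 2 : ℝ) / Real.log x ^ C ≤
        |∑ a ∈ Finset.Ioc ⌊A⌋₊ ⌊2 * A⌋₊,
          ∑ b ∈ (Finset.Icc 1 ⌊x / A⌋₊).filter (fun b => ¬ (b.Prime ∧ ⌊x / A⌋₊ < b * b)),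
            u a * v b * entry c a b| →
      ∃ g : ℕ → ℂ, (∀ m n : ℕ, g (m * n) = g m * g n) ∧ (∀ n : ℕ, ‖g n‖ ≤ 1) ∧
        ∃ y : ℝ, y ≤ x / A ∧
          x * (x / A) / Real.log x ^ C' ≤
            ∑ a ∈ Finset.Ioc ⌊A⌋₊ ⌊2 * A⌋₊,
              ‖∑ b ∈ Finset.Icc 1 ⌊y⌋₊, g b * (entry c a b : ℂ)‖ ^ 2

/-- THE RESIDUAL ON THE CONSTRAINED COLUMNS (registered stub `stub_residual_compositeCols`): `MeanSquareCM`
with the column sum restricted to the complement of the free columns. -/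
def ResidualCompositeCols : Prop :=
  ∀ c : ℤ, c ≠ 0 → ∀ δ : ℝ, 0 < δ → δ ≤ 1 / 12 → ∀ C : ℝ, 0 < C → ∃ x₀ : ℝ, ∀ x : ℝ, x₀ ≤ x →
    ∀ A : ℝ, x ^ δ ≤ A → A ≤ x ^ (1 / 3 + δ) →
    ∀ g : ℕ → ℂ, (∀ m n : ℕ, g (m * n) = g m * g n) → (∀ n : ℕ, ‖g n‖ ≤ 1) →
    ∀ y : ℝ, y ≤ x / A →
      ∑ a ∈ Finset.Ioc ⌊A⌋₊ ⌊2 * A⌋₊,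
          ‖∑ b ∈ (Finset.Icc 1 ⌊y⌋₊).filter (fun b => ¬ (b.Prime ∧ ⌊x / A⌋₊ < b * b)),
              g b * (entry c a b : ℂ)‖ ^ 2 ≤
        x * (x / A) / Real.log x ^ C

/-- The landed calibration T1 as a named statement (the lever on the free columns). -/
def InversePrimeCols : Prop :=
  ∀ c : ℤ, ∀ δ : ℝ, 0 < δ → δ ≤ 1 / 12 → ∀ C : ℝ, 0 < C → ∃ C' : ℝ, 0 < C' ∧ ∃ x₀ : ℝ,
    ∀ x : ℝ, x₀ ≤ x → ∀ A : ℝ, x ^ δ ≤ A → A ≤ x ^ (1 / 3 + δ) →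
    ∀ u v : ℕ → ℝ, (∑ a ∈ Finset.Ioc ⌊A⌋₊ ⌊2 * A⌋₊, u a ^ 2 ≤ 1) →
      (∑ b ∈ Finset.Icc 1 ⌊x / A⌋₊, v b ^ 2 ≤ 1) →
      x ^ (1 / 2 : ℝ) / Real.log x ^ C ≤
        |∑ a ∈ Finset.Ioc ⌊A⌋₊ ⌊2 * A⌋₊,
          ∑ b ∈ (Finset.Icc 1 ⌊x / A⌋₊).filter (fun b => b.Prime ∧ ⌊x / A⌋₊ < b * b),
            u a * v b * entry c a b| →
      ∃ g : ℕ → ℂ, (∀ m n : ℕ, g (m * n) = g m * g n) ∧ (∀ n : ℕ, ‖g n‖ ≤ 1) ∧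
        ∃ y : ℝ, y ≤ x / A ∧
          x * (x / A) / Real.log x ^ C' ≤
            ∑ a ∈ Finset.Ioc ⌊A⌋₊ ⌊2 * A⌋₊,
              ‖∑ b ∈ Finset.Icc 1 ⌊y⌋₊, g b * (entry c a b : ℂ)‖ ^ 2

/-- T1 holds (landed p87332). -/
theorem inversePrimeCols_holds : InversePrimeCols := stub_inverse_primeCols

/-! ### Glue 1: the lever splits along the free columns -/

/-- `InverseCM` from the lever on the free columns (T1) and the lever on the constrained columns: if
`|uᵀMv| ≥ √x/(log x)^C` then, splitting the columns at `S`, one of the two partial forms is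
`≥ ½·√x/(log x)^C ≥ √x/(log x)^{C+1}` once `log x ≥ 2`; take `C' = max C'₁ C'₂`. -/
theorem inverseCM_of_primeCols_compositeCols (hP : InversePrimeCols) (hQ : InverseCompositeCols) :
    InverseCM := by
  intro c hc δ hδ hδ' C hC
  obtain ⟨C₁, hC₁, x₁, h1⟩ := hP c δ hδ hδ' (C + 1) (by linarith)
  obtain ⟨C₂, hC₂, x₂, h2⟩ := hQ c hc δ hδ hδ' (C + 1) (by linarith)
  obtain ⟨X, hX⟩ := Negative.eventually_log_rpow_le hδ 1
  refine ⟨max C₁ C₂, lt_max_of_lt_left hC₁, max (max x₁ x₂) (max X 1), ?_⟩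
  intro x hx A hA hA' u v hu hv hbig
  simp only [max_le_iff] at hx
  obtain ⟨⟨hx₁, hx₂⟩, ⟨hxX, hx1⟩⟩ := hx
  have hL2 : 2 ≤ Real.log x := (hX x hxX).2
  have hLpos : 0 < Real.log x := by linarith
  have hL1 : 1 ≤ Real.log x := by linarith
  have hxpos : 0 < x := by linarith
  have hApos : 0 < A := lt_of_lt_of_le (Real.rpow_pos_of_pos hxpos δ) hA
  have hnum : 0 ≤ x * (x / A) := by positivity
  -- the split of the form
  set P : ℕ → Prop := fun b => b.Prime ∧ ⌊x / A⌋₊ < b * b with hPdef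
  set FS : ℝ := ∑ a ∈ Ioc ⌊A⌋₊ ⌊2 * A⌋₊, ∑ b ∈ (Icc 1 ⌊x / A⌋₊).filter (fun b => P b),
    u a * v b * entry c a b with hFS
  set FT : ℝ := ∑ a ∈ Ioc ⌊A⌋₊ ⌊2 * A⌋₊, ∑ b ∈ (Icc 1 ⌊x / A⌋₊).filter (fun b => ¬ P b),
    u a * v b * entry c a b with hFT
  have hsplit : ∑ a ∈ Ioc ⌊A⌋₊ ⌊2 * A⌋₊, ∑ b ∈ Icc 1 ⌊x / A⌋₊, u a * v b * entry c a b = FS + FT := by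
    rw [hFS, hFT, ← sum_add_distrib]
    refine sum_congr rfl fun a _ => ?_
    exact (sum_filter_add_sum_filter_not _ _ _).symm
  -- the two thresholds
  have hhalf : x ^ (1 / 2 : ℝ) / Real.log x ^ (C + 1) ≤ (x ^ (1 / 2 : ℝ) / Real.log x ^ C) / 2 := by
    rw [Real.rpow_add_one hLpos.ne' C, ← div_div]
    exact div_le_div_of_nonneg_left (by positivity) (by norm_num) hL2
  have hmono : ∀ {C' : ℝ}, C' ≤ max C₁ C₂ →
      x * (x / A) / Real.log x ^ (max C₁ C₂) ≤ x * (x / A) / Real.log x ^ C' := fun hle =>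
    div_le_div_of_nonneg_left hnum (Real.rpow_pos_of_pos hLpos _)
      (Real.rpow_le_rpow_of_exponent_le hL1 hle)
  rw [hsplit] at hbig
  by_cases hS : x ^ (1 / 2 : ℝ) / Real.log x ^ (C + 1) ≤ |FS|
  · obtain ⟨g, hgm, hgb, y, hy, hbig'⟩ := h1 x hx₁ A hA hA' u v hu hv hS
    exact ⟨g, hgm, hgb, y, hy, (hmono (le_max_left _ _)).trans hbig'⟩
  · push Not at hS
    have hT : x ^ (1 / 2 : ℝ) / Real.log x ^ (C + 1) ≤ |FT| := by
      have habs := abs_add_le FS FT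
      linarith
    obtain ⟨g, hgm, hgb, y, hy, hbig'⟩ := h2 x hx₂ A hA hA' u v hu hv hT
    exact ⟨g, hgm, hgb, y, hy, (hmono (le_max_right _ _)).trans hbig'⟩

/-! ### Glue 2: the residual splits along the free columns -/

/-- An operator-norm bound `K` on `ℓ²`-unit test vectors (`u` on `R`, `v` on `S' ⊇ S`, form over `R × S`)
bounds the quadratic form of EVERY real weight `t`: `∑_{a∈R} (∑_{b∈S} t_b e_{ab})² ≤ K² ∑_{b∈S} t_b²`
(normalise `t` and `M t`). -/
theorem sq_form_le_of_opNorm (e : ℕ → ℕ → ℝ) (R S S' : Finset ℕ) (hSS' : S ⊆ S') {K : ℝ}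
    (hop : ∀ u v : ℕ → ℝ, ∑ a ∈ R, u a ^ 2 ≤ 1 → ∑ b ∈ S', v b ^ 2 ≤ 1 →
      |∑ a ∈ R, ∑ b ∈ S, u a * v b * e a b| ≤ K)
    (t : ℕ → ℝ) : ∑ a ∈ R, (∑ b ∈ S, t b * e a b) ^ 2 ≤ K ^ 2 * ∑ b ∈ S, t b ^ 2 := by
  set I : ℕ → ℝ := fun a => ∑ b ∈ S, t b * e a b with hI
  set N : ℝ := ∑ a ∈ R, I a ^ 2 with hN
  set W : ℝ := ∑ b ∈ S, t b ^ 2 with hW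
  have hN0 : 0 ≤ N := sum_nonneg fun _ _ => sq_nonneg _
  have hW0 : 0 ≤ W := sum_nonneg fun _ _ => sq_nonneg _
  show N ≤ K ^ 2 * W
  by_cases hWz : W = 0
  · have ht0 : ∀ b ∈ S, t b = 0 := by
      intro b hb
      have hsq : t b ^ 2 = 0 := (sum_eq_zero_iff_of_nonneg (fun b _ => sq_nonneg (t b))).mp hWz b hb
      exact pow_eq_zero_iff two_ne_zero |>.mp hsq
    have hI0 : ∀ a, I a = 0 := fun a => sum_eq_zero fun b hb => by rw [ht0 b hb, zero_mul]
    have hN' : N = 0 := sum_eq_zero fun a _ => by rw [hI0 a]; ring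
    rw [hN', hWz, mul_zero]
  by_cases hNz : N = 0
  · rw [hNz]; positivity
  have hWpos : 0 < W := lt_of_le_of_ne hW0 (Ne.symm hWz)
  have hNpos : 0 < N := lt_of_le_of_ne hN0 (Ne.symm hNz)
  have hsW : Real.sqrt W ^ 2 = W := Real.sq_sqrt hW0
  have hsN : Real.sqrt N ^ 2 = N := Real.sq_sqrt hN0
  have hsWpos : 0 < Real.sqrt W := Real.sqrt_pos.mpr hWpos
  have hsNpos : 0 < Real.sqrt N := Real.sqrt_pos.mpr hNpos
  -- test vectors `u = M t/‖M t‖` on `R`, `v = t 𝟙_S/‖t‖` on `S'`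
  set v : ℕ → ℝ := fun b => if b ∈ S then t b / Real.sqrt W else 0 with hv
  have hv1 : ∑ b ∈ S', v b ^ 2 ≤ 1 := by
    have hvS' : ∑ b ∈ S', v b ^ 2 = ∑ b ∈ S, v b ^ 2 :=
      (sum_subset hSS' (fun b _ hbS => by simp [hv, hbS])).symm
    have hvS : ∑ b ∈ S, v b ^ 2 = ∑ b ∈ S, (t b / Real.sqrt W) ^ 2 :=
      sum_congr rfl fun b hb => by simp [hv, hb]
    rw [hvS', hvS]
    simp_rw [div_pow]
    rw [← sum_div, hsW, div_self hWz]
  have hu1 : ∑ a ∈ R, (I a / Real.sqrt N) ^ 2 ≤ 1 := by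
    simp_rw [div_pow]
    rw [← sum_div, hsN, div_self hNz]
  have hform : ∑ a ∈ R, ∑ b ∈ S, (I a / Real.sqrt N) * v b * e a b = Real.sqrt N / Real.sqrt W := by
    have hIa : ∀ a, ∑ b ∈ S, t b * e a b = I a := fun a => by simp only [hI]
    have hstep : ∀ a, ∑ b ∈ S, (I a / Real.sqrt N) * v b * e a b =
        I a ^ 2 / (Real.sqrt N * Real.sqrt W) := by
      intro a
      calc ∑ b ∈ S, (I a / Real.sqrt N) * v b * e a b
          = (I a / (Real.sqrt N * Real.sqrt W)) * ∑ b ∈ S, t b * e a b := by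
            rw [mul_sum]
            refine sum_congr rfl fun b hb => ?_
            simp only [hv, if_pos hb]
            ring
        _ = I a ^ 2 / (Real.sqrt N * Real.sqrt W) := by rw [hIa]; ring
    simp_rw [hstep]
    rw [← sum_div, ← hN]
    have key : ∀ s : ℝ, 0 < s → s ^ 2 = N → N / (s * Real.sqrt W) = s / Real.sqrt W := by
      intro s hs hs2
      rw [← hs2, sq, mul_div_mul_left _ _ hs.ne']
    exact key _ hsNpos hsN
  have hb := hop (fun a => I a / Real.sqrt N) v hu1 hv1
  rw [hform, abs_of_nonneg (div_nonneg hsNpos.le hsWpos.le), div_le_iff₀ hsWpos] at hb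
  calc N = Real.sqrt N ^ 2 := hsN.symm
    _ ≤ (K * Real.sqrt W) ^ 2 := pow_le_pow_left₀ hsNpos.le hb 2
    _ = K ^ 2 * W := by rw [mul_pow, hsW]

/-- `MeanSquareCM` from the unstructured core on the free columns and the residual on the constrained
columns: `‖∑_{b≤Y} g_b e_b‖² ≤ 2‖∑_{S} …‖² + 2‖∑_{Sᶜ} …‖²`; the second part is the constrained residual at
exponent `C+2`; the first is `(Re)² + (Im)²` with each real part `≤ K²·#S ≤ (x/(log x)^{C+3})·(x/A)` by
`sq_form_le_of_opNorm` with `K = √x/(log x)^{(C+3)/2}` from `PrimeCore` (restricted to the columns `≤ Y`);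
`4/(log x)³ + 2/(log x)² ≤ 1` for `log x ≥ 2`. -/
theorem meanSquareCM_of_primeCore_compositeCols (hP : PrimeCore) (hQ : ResidualCompositeCols) :
    MeanSquareCM := by
  intro c hc δ hδ hδ' C hC
  obtain ⟨x₁, h1⟩ := hP c hc δ hδ hδ' ((C + 3) / 2) (by linarith)
  obtain ⟨x₂, h2⟩ := hQ c hc δ hδ hδ' (C + 2) (by linarith)
  obtain ⟨X, hX⟩ := Negative.eventually_log_rpow_le hδ 1
  refine ⟨max (max x₁ x₂) (max X 1), ?_⟩
  intro x hx A hA hA' g hgm hgb y hy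
  simp only [max_le_iff] at hx
  obtain ⟨⟨hx₁, hx₂⟩, ⟨hxX, hx1⟩⟩ := hx
  have hL2 : 2 ≤ Real.log x := (hX x hxX).2
  have hLpos : 0 < Real.log x := by linarith
  have hxpos : 0 < x := by linarith
  have hx0 : 0 ≤ x := hxpos.le
  have hApos : 0 < A := lt_of_lt_of_le (Real.rpow_pos_of_pos hxpos δ) hA
  have hxA0 : 0 ≤ x / A := div_nonneg hx0 hApos.le
  have hnum : 0 ≤ x * (x / A) := by positivity
  set L : ℝ := Real.log x with hL
  set B : ℕ := ⌊x / A⌋₊ with hB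
  set Y : ℕ := ⌊y⌋₊ with hY
  set P : ℕ → Prop := fun b => b.Prime ∧ B < b * b with hPdef
  have hYB : Y ≤ B := by
    rcases le_or_gt 0 y with hy0 | hy0
    · exact Nat.floor_mono hy
    · rw [hY, Nat.floor_of_nonpos hy0.le]; exact Nat.zero_le _
  -- the split of each row sum
  set SY : Finset ℕ := (Icc 1 Y).filter (fun b => P b) with hSY
  set TY : Finset ℕ := (Icc 1 Y).filter (fun b => ¬ P b) with hTY
  have hrow : ∀ a, ∑ b ∈ Icc 1 Y, g b * (entry c a b : ℂ) =
      ∑ b ∈ SY, g b * (entry c a b : ℂ) + ∑ b ∈ TY, g b * (entry c a b : ℂ) := fun a =>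
    (sum_filter_add_sum_filter_not _ _ _).symm
  -- (i) the constrained part
  have hT : ∑ a ∈ Ioc ⌊A⌋₊ ⌊2 * A⌋₊, ‖∑ b ∈ TY, g b * (entry c a b : ℂ)‖ ^ 2 ≤
      x * (x / A) / L ^ (C + 2) := h2 x hx₂ A hA hA' g hgm hgb y hy
  -- (ii) the free part, real and imaginary parts through the core
  have hSYsub : SY ⊆ (Icc 1 B).filter (fun b => P b) := by
    intro b hb
    simp only [hSY, mem_filter, mem_Icc] at hb ⊢
    exact ⟨⟨hb.1.1, hb.1.2.trans hYB⟩, hb.2⟩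
  have hop : ∀ u v : ℕ → ℝ, ∑ a ∈ Ioc ⌊A⌋₊ ⌊2 * A⌋₊, u a ^ 2 ≤ 1 → ∑ b ∈ Icc 1 B, v b ^ 2 ≤ 1 →
      |∑ a ∈ Ioc ⌊A⌋₊ ⌊2 * A⌋₊, ∑ b ∈ SY, u a * v b * entry c a b| ≤
        x ^ (1 / 2 : ℝ) / L ^ ((C + 3) / 2) := by
    intro u v hu hv
    -- restrict `v` to the columns `≤ Y`: still unit on `Icc 1 B`
    set v' : ℕ → ℝ := fun b => if b ∈ SY then v b else 0 with hv'
    have hv'1 : ∑ b ∈ Icc 1 B, v' b ^ 2 ≤ 1 := by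
      refine le_trans (sum_le_sum fun b _ => ?_) hv
      simp only [hv']
      split_ifs
      · exact le_rfl
      · rw [zero_pow two_ne_zero]; exact sq_nonneg _
    have hb := h1 x hx₁ A hA hA' u v' hu hv'1
    have heq : ∑ a ∈ Ioc ⌊A⌋₊ ⌊2 * A⌋₊, ∑ b ∈ (Icc 1 B).filter (fun b => P b), u a * v' b * entry c a b
        = ∑ a ∈ Ioc ⌊A⌋₊ ⌊2 * A⌋₊, ∑ b ∈ SY, u a * v b * entry c a b := by
      refine sum_congr rfl fun a _ => ?_
      have h1 : ∑ b ∈ (Icc 1 B).filter (fun b => P b), u a * v' b * entry c a b =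
          ∑ b ∈ SY, u a * v' b * entry c a b :=
        (sum_subset hSYsub (fun b _ hbS => by simp [hv', hbS])).symm
      rw [h1]
      exact sum_congr rfl fun b hb => by simp [hv', hb]
    rw [heq] at hb
    exact hb
  have hcore : ∀ t : ℕ → ℝ, (∀ b, |t b| ≤ 1) →
      ∑ a ∈ Ioc ⌊A⌋₊ ⌊2 * A⌋₊, (∑ b ∈ SY, t b * entry c a b) ^ 2 ≤ x / L ^ (C + 3) * (x / A) := by
    intro t ht
    have h := sq_form_le_of_opNorm (entry c) (Ioc ⌊A⌋₊ ⌊2 * A⌋₊) SY (Icc 1 B)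
      (hSYsub.trans (filter_subset _ _)) hop t
    have hK2 : (x ^ (1 / 2 : ℝ) / L ^ ((C + 3) / 2)) ^ 2 = x / L ^ (C + 3) := by
      rw [div_pow, ← Real.rpow_natCast, ← Real.rpow_natCast, ← Real.rpow_mul hx0,
        ← Real.rpow_mul hLpos.le]
      norm_num
    have ht2 : ∑ b ∈ SY, t b ^ 2 ≤ x / A := by
      calc ∑ b ∈ SY, t b ^ 2 ≤ ∑ _b ∈ SY, (1 : ℝ) := sum_le_sum fun b _ => by
              have h1 := ht b
              rw [← sq_abs]; nlinarith [abs_nonneg (t b)]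
        _ = (SY.card : ℝ) := by simp
        _ ≤ ((Icc 1 B).card : ℝ) := by
            exact_mod_cast card_le_card (hSYsub.trans (filter_subset _ _))
        _ = B := by simp
        _ ≤ x / A := Nat.floor_le hxA0
    calc _ ≤ (x ^ (1 / 2 : ℝ) / L ^ ((C + 3) / 2)) ^ 2 * ∑ b ∈ SY, t b ^ 2 := h
      _ ≤ x / L ^ (C + 3) * (x / A) := by
          rw [hK2]
          exact mul_le_mul_of_nonneg_left ht2 (by positivity)
  have hS : ∑ a ∈ Ioc ⌊A⌋₊ ⌊2 * A⌋₊, ‖∑ b ∈ SY, g b * (entry c a b : ℂ)‖ ^ 2 ≤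
      2 * (x / L ^ (C + 3) * (x / A)) := by
    have hre := hcore (fun b => (g b).re) fun b =>
      (Complex.abs_re_le_norm (g b)).trans (hgb b)
    have him := hcore (fun b => (g b).im) fun b =>
      (Complex.abs_im_le_norm (g b)).trans (hgb b)
    calc _ = ∑ a ∈ Ioc ⌊A⌋₊ ⌊2 * A⌋₊, ((∑ b ∈ SY, (g b).re * entry c a b) ^ 2 +
          (∑ b ∈ SY, (g b).im * entry c a b) ^ 2) :=
          sum_congr rfl fun a _ => Negative.norm_sq_sum_mul_ofReal g (entry c a) SY
      _ = _ + _ := sum_add_distrib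
      _ ≤ x / L ^ (C + 3) * (x / A) + x / L ^ (C + 3) * (x / A) := add_le_add hre him
      _ = 2 * (x / L ^ (C + 3) * (x / A)) := by ring
  -- (iii) assemble: `‖P + Q‖² ≤ 2‖P‖² + 2‖Q‖²`
  have hsq : ∀ a, ‖∑ b ∈ Icc 1 Y, g b * (entry c a b : ℂ)‖ ^ 2 ≤
      2 * ‖∑ b ∈ SY, g b * (entry c a b : ℂ)‖ ^ 2 + 2 * ‖∑ b ∈ TY, g b * (entry c a b : ℂ)‖ ^ 2 := by
    intro a
    rw [hrow a]
    have h := norm_add_le (∑ b ∈ SY, g b * (entry c a b : ℂ)) (∑ b ∈ TY, g b * (entry c a b : ℂ))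
    have h0 := norm_nonneg (∑ b ∈ SY, g b * (entry c a b : ℂ) + ∑ b ∈ TY, g b * (entry c a b : ℂ))
    nlinarith [sq_nonneg (‖∑ b ∈ SY, g b * (entry c a b : ℂ)‖ - ‖∑ b ∈ TY, g b * (entry c a b : ℂ)‖)]
  have hL3 : L ^ (C + 3) = L ^ C * L ^ (3 : ℝ) := Real.rpow_add hLpos C 3
  have hL2' : L ^ (C + 2) = L ^ C * L ^ (2 : ℝ) := Real.rpow_add hLpos C 2
  have hL3v : (8 : ℝ) ≤ L ^ (3 : ℝ) := by
    rw [show (3 : ℝ) = ((3 : ℕ) : ℝ) by norm_num, Real.rpow_natCast]; nlinarith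
  have hL2v : (4 : ℝ) ≤ L ^ (2 : ℝ) := by
    rw [show (2 : ℝ) = ((2 : ℕ) : ℝ) by norm_num, Real.rpow_natCast]; nlinarith
  have hLC : 0 < L ^ C := Real.rpow_pos_of_pos hLpos C
  calc ∑ a ∈ Ioc ⌊A⌋₊ ⌊2 * A⌋₊, ‖∑ b ∈ Icc 1 Y, g b * (entry c a b : ℂ)‖ ^ 2
      ≤ ∑ a ∈ Ioc ⌊A⌋₊ ⌊2 * A⌋₊, (2 * ‖∑ b ∈ SY, g b * (entry c a b : ℂ)‖ ^ 2 +
          2 * ‖∑ b ∈ TY, g b * (entry c a b : ℂ)‖ ^ 2) := sum_le_sum fun a _ => hsq a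
    _ = 2 * ∑ a ∈ Ioc ⌊A⌋₊ ⌊2 * A⌋₊, ‖∑ b ∈ SY, g b * (entry c a b : ℂ)‖ ^ 2 +
          2 * ∑ a ∈ Ioc ⌊A⌋₊ ⌊2 * A⌋₊, ‖∑ b ∈ TY, g b * (entry c a b : ℂ)‖ ^ 2 := by
        rw [sum_add_distrib, mul_sum, mul_sum]
    _ ≤ 2 * (2 * (x / L ^ (C + 3) * (x / A))) + 2 * (x * (x / A) / L ^ (C + 2)) := by
        gcongr
    _ = x * (x / A) / L ^ C * (4 / L ^ (3 : ℝ) + 2 / L ^ (2 : ℝ)) := by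
        rw [hL3, hL2']
        field_simp
        ring
    _ ≤ x * (x / A) / L ^ C * 1 := by
        refine mul_le_mul_of_nonneg_left ?_ (by positivity)
        have h8 : 4 / L ^ (3 : ℝ) ≤ 1 / 2 := by
          rw [div_le_div_iff₀ (by positivity) (by norm_num)]; linarith
        have h4 : 2 / L ^ (2 : ℝ) ≤ 1 / 2 := by
          rw [div_le_div_iff₀ (by positivity) (by norm_num)]; linarith
        linarith
    _ = x * (x / A) / L ^ C := mul_one _

end Anatomy

/-! ## The r3/r4 stubs DERIVED from the r5 anatomy, the named statements, and THE SKELETON -/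

section Derived

open Summit.Parity.GeneralizedHardyLittlewood.Theorems.TableChowla

/-- `PrimeCore` is literally the registered stub `stub_primeCore`. -/
theorem primeCore_holds : PrimeCore := stub_primeCore

/-- `InverseCompositeCols` is literally the registered stub `stub_inverse_compositeCols`. -/
theorem inverseCompositeCols_holds : InverseCompositeCols := stub_inverse_compositeCols

/-- `ResidualCompositeCols` is literally the registered stub `stub_residual_compositeCols`. -/
theorem residualCompositeCols_holds : ResidualCompositeCols := stub_residual_compositeCols

/-- The r3 stub `stub_inverse` (`InverseCM` inlined), now DERIVED: T1 (landed) + the constrained-column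
lever. -/
theorem stub_inverse :
    ∀ c : ℤ, c ≠ 0 → ∀ δ : ℝ, 0 < δ → δ ≤ 1 / 12 → ∀ C : ℝ, 0 < C → ∃ C' : ℝ, 0 < C' ∧ ∃ x₀ : ℝ,
    ∀ x : ℝ, x₀ ≤ x → ∀ A : ℝ, x ^ δ ≤ A → A ≤ x ^ (1 / 3 + δ) →
    ∀ u v : ℕ → ℝ, (∑ a ∈ Finset.Ioc ⌊A⌋₊ ⌊2 * A⌋₊, u a ^ 2 ≤ 1) →
      (∑ b ∈ Finset.Icc 1 ⌊x / A⌋₊, v b ^ 2 ≤ 1) →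
      x ^ (1 / 2 : ℝ) / Real.log x ^ C ≤
        |∑ a ∈ Finset.Ioc ⌊A⌋₊ ⌊2 * A⌋₊, ∑ b ∈ Finset.Icc 1 ⌊x / A⌋₊,
          u a * v b * (ArithmeticFunction.liouville (Int.toNat ((a : ℤ) * b + c)) : ℝ)| →
      ∃ g : ℕ → ℂ, (∀ m n : ℕ, g (m * n) = g m * g n) ∧ (∀ n : ℕ, ‖g n‖ ≤ 1) ∧
        ∃ y : ℝ, y ≤ x / A ∧
          x * (x / A) / Real.log x ^ C' ≤
            ∑ a ∈ Finset.Ioc ⌊A⌋₊ ⌊2 * A⌋₊,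
              ‖∑ b ∈ Finset.Icc 1 ⌊y⌋₊, g b *
                ((ArithmeticFunction.liouville (Int.toNat ((a : ℤ) * b + c)) : ℝ) : ℂ)‖ ^ 2 :=
  inverseCM_of_primeCols_compositeCols inversePrimeCols_holds inverseCompositeCols_holds

/-- The r3 stub `stub_residualCM` (`MeanSquareCM` inlined), now DERIVED: the unstructured core + the
constrained-column residual. -/
theorem stub_residualCM :
    ∀ c : ℤ, c ≠ 0 → ∀ δ : ℝ, 0 < δ → δ ≤ 1 / 12 → ∀ C : ℝ, 0 < C → ∃ x₀ : ℝ, ∀ x : ℝ, x₀ ≤ x →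
    ∀ A : ℝ, x ^ δ ≤ A → A ≤ x ^ (1 / 3 + δ) →
    ∀ g : ℕ → ℂ, (∀ m n : ℕ, g (m * n) = g m * g n) → (∀ n : ℕ, ‖g n‖ ≤ 1) →
    ∀ y : ℝ, y ≤ x / A →
      ∑ a ∈ Finset.Ioc ⌊A⌋₊ ⌊2 * A⌋₊,
          ‖∑ b ∈ Finset.Icc 1 ⌊y⌋₊, g b *
            ((ArithmeticFunction.liouville (Int.toNat ((a : ℤ) * b + c)) : ℝ) : ℂ)‖ ^ 2 ≤
        x * (x / A) / Real.log x ^ C :=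
  meanSquareCM_of_primeCore_compositeCols primeCore_holds residualCompositeCols_holds

/-- The lever statement `InverseCM` is literally `stub_inverse`. -/
theorem inverseCM_holds : InverseCM := stub_inverse

/-- The residual statement `MeanSquareCM` is literally `stub_residualCM`. -/
theorem meanSquareCM_holds : MeanSquareCM := stub_residualCM

/-- Hence (trivially) its column-aperiodic restriction — recorded only to keep the r2 vocabulary. -/
theorem meanSquareCMAperiodicCols_holds : MeanSquareCMAperiodicCols := by
  intro c hc δ hδ hδ' C hC
  obtain ⟨x₀, h⟩ := meanSquareCM_holds c hc δ hδ hδ' C hC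
  exact ⟨1, one_pos, x₀, fun x hx A hA hA' g hgm hgb _ y hy => h x hx A hA hA' g hgm hgb y hy⟩

/-- THE SKELETON: the crux BY NAME from the registered stubs (no `sorry` of its own — it is closed
exactly when `stub_primeCore`, `stub_inverse_compositeCols` and `stub_residual_compositeCols` are). -/
theorem TableChowla_of :
    Summit.Parity.GeneralizedHardyLittlewood.Theses.LiouvilleShiftedTables.TableChowla :=
  Summit.Parity.GeneralizedHardyLittlewood.Theorems.TableChowla.Negative.tableChowla_iff.mpr
    (tableChowlaFor_of_stubs inverseCM_holds meanSquareCM_holds)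

/-- The hypothetical form with the crux named (an `example`, so that no second theorem concludes the crux):
`PrimeCore → InverseCompositeCols → ResidualCompositeCols → TableChowla` (T1 is a landed theorem). -/
example :
    PrimeCore → InverseCompositeCols → ResidualCompositeCols →
      Summit.Parity.GeneralizedHardyLittlewood.Theses.LiouvilleShiftedTables.TableChowla :=
  fun hP hI hR =>
    Summit.Parity.GeneralizedHardyLittlewood.Theorems.TableChowla.Negative.tableChowla_iff.mpr
      (tableChowlaFor_of_stubs (inverseCM_of_primeCols_compositeCols inversePrimeCols_holds hI)
        (meanSquareCM_of_primeCore_compositeCols hP hR))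

end Derived

/-! ## Honesty of the cut (real proofs): the crux implies the whole residual

`TableChowla → MeanSquareCM` (hence `→ MeanSquareCMPeriodic ∧ MeanSquareCMAperiodic`): the residual
stubs are NOT stronger than the crux. Mechanism: `‖M g‖² = ∑_{b,b'} Re(g_b ḡ_{b'})·G(b,b')` with
`G = MᵀM`, one real Cauchy–Schwarz, and the column/row duality `∑ G² = tr(MMᵀ)²` landed in
`Theorems/TableChowla/Negative/TableChowlaTightness.lean` (`Negative.momentN_eq_colMoment`). -/

section Necessity

open Finset
open Summit.Parity.GeneralizedHardyLittlewood.Theorems.TableChowla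

/-- Mean square against arbitrary complex column weights is controlled by the fourth moment:
`∑_{a ∈ R} ‖∑_{b ∈ S} g_b e_{ab}‖² ≤ (∑_{b ∈ S} ‖g_b‖²) · √(∑_{b,b' ∈ S'} (∑_{a ∈ R} e_{ab} e_{ab'})²)`
for `S ⊆ S'` (`‖Mg‖² ≤ ‖g‖²·‖MᵀM‖_F`). -/
theorem meanSquare_le_norm_sq_mul_sqrt (c : ℤ) (R S S' : Finset ℕ) (hS : S ⊆ S') (g : ℕ → ℂ) :
    ∑ a ∈ R, ‖∑ b ∈ S, g b * (entry c a b : ℂ)‖ ^ 2 ≤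
      (∑ b ∈ S, ‖g b‖ ^ 2) *
        Real.sqrt (∑ b ∈ S', ∑ b' ∈ S', (∑ a ∈ R, entry c a b * entry c a b') ^ 2) := by
  -- the real Gram kernel of the columns and the real coefficient matrix of `g ⊗ ḡ`
  set G : ℕ → ℕ → ℝ := fun b b' => ∑ a ∈ R, entry c a b * entry c a b' with hG
  set h : ℕ → ℕ → ℝ := fun b b' => (g b * (starRingEnd ℂ) (g b')).re with hh
  -- Step 1: expansion `∑_a ‖v_a‖² = ∑_{b,b'} h(b,b') G(b,b')`
  have hsq : ∀ a : ℕ, ‖∑ b ∈ S, g b * (entry c a b : ℂ)‖ ^ 2 =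
      ∑ b ∈ S, ∑ b' ∈ S, h b b' * (entry c a b * entry c a b') := by
    intro a
    set v : ℂ := ∑ b ∈ S, g b * (entry c a b : ℂ) with hv
    have h1 : ‖v‖ ^ 2 = (v * (starRingEnd ℂ) v).re := by
      rw [Complex.mul_conj, Complex.ofReal_re, Complex.normSq_eq_norm_sq]
    have h2 : (starRingEnd ℂ) v = ∑ b' ∈ S, (starRingEnd ℂ) (g b') * (entry c a b' : ℂ) := by
      rw [hv, map_sum]
      refine sum_congr rfl fun b' _ => ?_
      rw [map_mul, Complex.conj_ofReal]
    rw [h1, h2, hv, sum_mul_sum, Complex.re_sum]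
    refine sum_congr rfl fun b _ => ?_
    rw [Complex.re_sum]
    refine sum_congr rfl fun b' _ => ?_
    have : g b * (entry c a b : ℂ) * ((starRingEnd ℂ) (g b') * (entry c a b' : ℂ)) =
        (g b * (starRingEnd ℂ) (g b')) * ((entry c a b * entry c a b' : ℝ) : ℂ) := by
      push_cast; ring
    rw [this, Complex.mul_re, Complex.ofReal_re, Complex.ofReal_im, mul_zero, sub_zero]
  have hexp : ∑ a ∈ R, ‖∑ b ∈ S, g b * (entry c a b : ℂ)‖ ^ 2 =
      ∑ b ∈ S, ∑ b' ∈ S, h b b' * G b b' := by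
    simp_rw [hsq]
    rw [sum_comm]
    refine sum_congr rfl fun b _ => ?_
    rw [sum_comm]
    refine sum_congr rfl fun b' _ => ?_
    rw [hG, mul_sum]
  -- Step 2: Cauchy–Schwarz over the pair index set `S ×ˢ S`
  have hpair : ∑ b ∈ S, ∑ b' ∈ S, h b b' * G b b' =
      ∑ p ∈ S ×ˢ S, h p.1 p.2 * G p.1 p.2 :=
    (sum_product' (s := S) (t := S) (f := fun b b' => h b b' * G b b')).symm
  have hCS : (∑ p ∈ S ×ˢ S, h p.1 p.2 * G p.1 p.2) ^ 2 ≤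
      (∑ p ∈ S ×ˢ S, h p.1 p.2 ^ 2) * ∑ p ∈ S ×ˢ S, G p.1 p.2 ^ 2 :=
    sum_mul_sq_le_sq_mul_sq _ _ _
  -- `h(b,b')² ≤ ‖g_b‖² ‖g_{b'}‖²`
  have hh2 : ∑ p ∈ S ×ˢ S, h p.1 p.2 ^ 2 ≤ (∑ b ∈ S, ‖g b‖ ^ 2) ^ 2 := by
    calc ∑ p ∈ S ×ˢ S, h p.1 p.2 ^ 2 ≤ ∑ p ∈ S ×ˢ S, ‖g p.1‖ ^ 2 * ‖g p.2‖ ^ 2 := by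
          refine sum_le_sum fun p _ => ?_
          rw [hh]
          dsimp only
          calc (g p.1 * (starRingEnd ℂ) (g p.2)).re ^ 2
              = (g p.1 * (starRingEnd ℂ) (g p.2)).re * (g p.1 * (starRingEnd ℂ) (g p.2)).re := sq _
            _ ≤ Complex.normSq (g p.1 * (starRingEnd ℂ) (g p.2)) := Complex.re_sq_le_normSq _
            _ = ‖g p.1‖ ^ 2 * ‖g p.2‖ ^ 2 := by
                rw [Complex.normSq_mul, Complex.normSq_conj, Complex.normSq_eq_norm_sq,
                  Complex.normSq_eq_norm_sq]
      _ = (∑ b ∈ S, ‖g b‖ ^ 2) ^ 2 := by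
          rw [sq (∑ b ∈ S, ‖g b‖ ^ 2), sum_mul_sum, ← sum_product']
  -- `∑_{S×S} G² ≤ ∑_{S'×S'} G²`
  have hGmono : ∑ p ∈ S ×ˢ S, G p.1 p.2 ^ 2 ≤
      ∑ b ∈ S', ∑ b' ∈ S', (∑ a ∈ R, entry c a b * entry c a b') ^ 2 := by
    rw [← sum_product' (f := fun b b' => (∑ a ∈ R, entry c a b * entry c a b') ^ 2)]
    refine sum_le_sum_of_subset_of_nonneg (product_subset_product hS hS) ?_
    intro p _ _
    positivity
  -- assemble
  have hg0 : 0 ≤ ∑ b ∈ S, ‖g b‖ ^ 2 := sum_nonneg fun b _ => by positivity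
  rw [hexp, hpair]
  calc ∑ p ∈ S ×ˢ S, h p.1 p.2 * G p.1 p.2
      ≤ |∑ p ∈ S ×ˢ S, h p.1 p.2 * G p.1 p.2| := le_abs_self _
    _ ≤ Real.sqrt ((∑ b ∈ S, ‖g b‖ ^ 2) ^ 2 *
          ∑ b ∈ S', ∑ b' ∈ S', (∑ a ∈ R, entry c a b * entry c a b') ^ 2) := by
        refine Real.abs_le_sqrt (le_trans hCS ?_)
        exact mul_le_mul hh2 hGmono (sum_nonneg fun p _ => by positivity) (by positivity)
    _ = (∑ b ∈ S, ‖g b‖ ^ 2) *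
          Real.sqrt (∑ b ∈ S', ∑ b' ∈ S', (∑ a ∈ R, entry c a b * entry c a b') ^ 2) := by
        rw [Real.sqrt_mul (sq_nonneg _), Real.sqrt_sq hg0]

/-- HONESTY: the crux implies the full residual `MeanSquareCM` (so neither residual stub is stronger
than the crux). From the crux at level `2C`: `‖M g‖² ≤ ‖g‖² √T ≤ (x/A) · x/(log x)^C`. -/
theorem meanSquareCM_of_tableChowla (hTC : TableChowla) : MeanSquareCM := by
  intro c hc δ hδ hδ' C hC
  have hTC' : Negative.TableChowlaFor Negative.lam := Negative.tableChowla_iff.mp hTC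
  obtain ⟨x₀, hx₀⟩ := hTC' c hc δ hδ hδ' (2 * C) (by linarith)
  refine ⟨max x₀ 1, ?_⟩
  intro x hx A hA hA' g hgm hgb y hy
  have hx₀' : x₀ ≤ x := le_trans (le_max_left _ _) hx
  have hx1 : (1 : ℝ) ≤ x := le_trans (le_max_right _ _) hx
  have hx0 : (0 : ℝ) ≤ x := by linarith
  have hxpos : (0 : ℝ) < x := by linarith
  have hApos : 0 < A := lt_of_lt_of_le (Real.rpow_pos_of_pos hxpos δ) hA
  have hL0 : 0 ≤ Real.log x := Real.log_nonneg hx1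
  -- the crux's moment in column form
  have hT : ∑ b ∈ Icc 1 ⌊x / A⌋₊, ∑ b' ∈ Icc 1 ⌊x / A⌋₊,
      (∑ a ∈ Ioc ⌊A⌋₊ ⌊2 * A⌋₊, entry c a b * entry c a b') ^ 2 ≤
        x ^ 2 / Real.log x ^ (2 * C) := by
    have hm := hx₀ x hx₀' A hA hA'
    unfold Negative.moment at hm
    rw [Negative.momentN_eq_colMoment] at hm
    exact hm
  -- columns `≤ ⌊y⌋` sit inside the crux's columns `≤ ⌊x/A⌋`
  have hsub : Icc 1 ⌊y⌋₊ ⊆ Icc 1 ⌊x / A⌋₊ := Icc_subset_Icc_right (Nat.floor_mono hy)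
  have hms := meanSquare_le_norm_sq_mul_sqrt c (Ioc ⌊A⌋₊ ⌊2 * A⌋₊) (Icc 1 ⌊y⌋₊)
    (Icc 1 ⌊x / A⌋₊) hsub g
  -- `‖g‖² ≤ ⌊y⌋ ≤ x/A`
  have hg2 : ∑ b ∈ Icc 1 ⌊y⌋₊, ‖g b‖ ^ 2 ≤ x / A := by
    calc ∑ b ∈ Icc 1 ⌊y⌋₊, ‖g b‖ ^ 2 ≤ ∑ _b ∈ Icc 1 ⌊y⌋₊, (1 : ℝ) :=
          sum_le_sum fun b _ => pow_le_one₀ (norm_nonneg _) (hgb b)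
      _ = (⌊y⌋₊ : ℝ) := by simp
      _ ≤ (⌊x / A⌋₊ : ℝ) := by exact_mod_cast Nat.floor_mono hy
      _ ≤ x / A := Nat.floor_le (div_nonneg hx0 hApos.le)
  -- `√T ≤ x/(log x)^C`
  have hsqrt : Real.sqrt (∑ b ∈ Icc 1 ⌊x / A⌋₊, ∑ b' ∈ Icc 1 ⌊x / A⌋₊,
      (∑ a ∈ Ioc ⌊A⌋₊ ⌊2 * A⌋₊, entry c a b * entry c a b') ^ 2) ≤ x / Real.log x ^ C := by
    have hpow : Real.log x ^ (2 * C) = (Real.log x ^ C) ^ 2 := by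
      rw [mul_comm, Real.rpow_mul hL0, Real.rpow_two]
    calc Real.sqrt _ ≤ Real.sqrt (x ^ 2 / Real.log x ^ (2 * C)) := Real.sqrt_le_sqrt hT
      _ = x / Real.log x ^ C := by
          rw [hpow, ← div_pow, Real.sqrt_sq (div_nonneg hx0 (Real.rpow_nonneg hL0 C))]
  calc ∑ a ∈ Ioc ⌊A⌋₊ ⌊2 * A⌋₊, ‖∑ b ∈ Icc 1 ⌊y⌋₊, g b * (entry c a b : ℂ)‖ ^ 2
      ≤ (∑ b ∈ Icc 1 ⌊y⌋₊, ‖g b‖ ^ 2) *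
          Real.sqrt (∑ b ∈ Icc 1 ⌊x / A⌋₊, ∑ b' ∈ Icc 1 ⌊x / A⌋₊,
            (∑ a ∈ Ioc ⌊A⌋₊ ⌊2 * A⌋₊, entry c a b * entry c a b') ^ 2) := hms
    _ ≤ (x / A) * (x / Real.log x ^ C) :=
        mul_le_mul hg2 hsqrt (Real.sqrt_nonneg _) (div_nonneg hx0 hApos.le)
    _ = x * (x / A) / Real.log x ^ C := by ring

/-- Consequently the crux implies both residual stubs' statements. -/
theorem meanSquareCMPeriodic_of_tableChowla (hTC : TableChowla) : MeanSquareCMPeriodic := by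
  intro c hc δ hδ hδ' C hC K hK
  obtain ⟨x₀, h⟩ := meanSquareCM_of_tableChowla hTC c hc δ hδ hδ' C hC
  exact ⟨x₀, fun x hx A hA hA' g hgm hgb q _ _ _ y hy => h x hx A hA hA' g hgm hgb y hy⟩

theorem meanSquareCMAperiodic_of_tableChowla (hTC : TableChowla) : MeanSquareCMAperiodic := by
  intro c hc δ hδ hδ' C hC
  obtain ⟨x₀, h⟩ := meanSquareCM_of_tableChowla hTC c hc δ hδ hδ' C hC
  exact ⟨1, one_pos, x₀, fun x hx A hA hA' g hgm hgb _ y hy => h x hx A hA hA' g hgm hgb y hy⟩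

end Necessity


/-! ## The converse calibrations (real proofs): the crux implies `C⁺` and (vacuously) the lever

`TableChowla → OperatorNormForm` (`(uᵀMv)⁴ ≤ ‖Mv‖⁴ ≤ T`, cf. triage r1-3's `bilinear_pow_four_le`)
and hence `TableChowla → InverseCM` (under the crux the hypothesis of the inverse theorem never fires:
triage r1-3's `inverseMH_of_tableChowla`, here for the one-sided `InverseCM`). Together with
`meanSquareCM_of_tableChowla` and `TableChowla_of`: the registered stub set is an EXACT splitting,
`TableChowla ↔ (InverseCM ∧ MeanSquareCMPeriodic ∧ MeanSquareCMAperiodic)` (`tableChowla_iff_stubs`). -/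

section Converse

open Finset
open Summit.Parity.GeneralizedHardyLittlewood.Theorems.TableChowla


/-- `C⁺` from the crux: `|uᵀ M v| ≤ ‖u‖·‖M v‖ ≤ T^{1/4} ≤ √x/(log x)^C` from the crux at level `4C`. -/
theorem operatorNormForm_of_tableChowla (hTC : TableChowla) : OperatorNormForm := by
  intro c hc δ hδ hδ' C hC
  have hTC' : Negative.TableChowlaFor Negative.lam := Negative.tableChowla_iff.mp hTC
  obtain ⟨x₀, hx₀⟩ := hTC' c hc δ hδ hδ' (4 * C) (by linarith)
  refine ⟨max x₀ 1, ?_⟩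
  intro x hx A hA hA' u v hu hv
  have hx₀' : x₀ ≤ x := le_trans (le_max_left _ _) hx
  have hx1 : (1 : ℝ) ≤ x := le_trans (le_max_right _ _) hx
  have hx0 : (0 : ℝ) ≤ x := by linarith
  have hL0 : 0 ≤ Real.log x := Real.log_nonneg hx1
  -- the crux's moment in column form
  have hT : ∑ b ∈ Icc 1 ⌊x / A⌋₊, ∑ b' ∈ Icc 1 ⌊x / A⌋₊,
      (∑ a ∈ Ioc ⌊A⌋₊ ⌊2 * A⌋₊, entry c a b * entry c a b') ^ 2 ≤
        x ^ 2 / Real.log x ^ (4 * C) := by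
    have hm := hx₀ x hx₀' A hA hA'
    unfold Negative.moment at hm
    rw [Negative.momentN_eq_colMoment] at hm
    exact hm
  -- `‖M v‖² ≤ ‖v‖² √T ≤ √T`
  set m : ℕ → ℝ := fun a => ∑ b ∈ Icc 1 ⌊x / A⌋₊, v b * entry c a b with hm_def
  have hms := meanSquare_le_norm_sq_mul_sqrt c (Ioc ⌊A⌋₊ ⌊2 * A⌋₊) (Icc 1 ⌊x / A⌋₊)
    (Icc 1 ⌊x / A⌋₊) (Subset.refl _) (fun b => (v b : ℂ))
  have hreal : ∀ a : ℕ, ‖∑ b ∈ Icc 1 ⌊x / A⌋₊, (v b : ℂ) * (entry c a b : ℂ)‖ ^ 2 = m a ^ 2 := by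
    intro a
    have : ∑ b ∈ Icc 1 ⌊x / A⌋₊, (v b : ℂ) * (entry c a b : ℂ) = ((m a : ℝ) : ℂ) := by
      rw [hm_def]
      push_cast
      rfl
    rw [this, Complex.norm_real, Real.norm_eq_abs, sq_abs]
  have hvnorm : ∑ b ∈ Icc 1 ⌊x / A⌋₊, ‖(v b : ℂ)‖ ^ 2 = ∑ b ∈ Icc 1 ⌊x / A⌋₊, v b ^ 2 := by
    refine sum_congr rfl fun b _ => ?_
    rw [Complex.norm_real, Real.norm_eq_abs, sq_abs]
  simp_rw [hreal] at hms
  rw [hvnorm] at hms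
  have hsqrtT0 : 0 ≤ Real.sqrt (∑ b ∈ Icc 1 ⌊x / A⌋₊, ∑ b' ∈ Icc 1 ⌊x / A⌋₊,
      (∑ a ∈ Ioc ⌊A⌋₊ ⌊2 * A⌋₊, entry c a b * entry c a b') ^ 2) := Real.sqrt_nonneg _
  have hMv : ∑ a ∈ Ioc ⌊A⌋₊ ⌊2 * A⌋₊, m a ^ 2 ≤ Real.sqrt (x ^ 2 / Real.log x ^ (4 * C)) :=
    calc ∑ a ∈ Ioc ⌊A⌋₊ ⌊2 * A⌋₊, m a ^ 2
        ≤ (∑ b ∈ Icc 1 ⌊x / A⌋₊, v b ^ 2) * Real.sqrt (∑ b ∈ Icc 1 ⌊x / A⌋₊,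
            ∑ b' ∈ Icc 1 ⌊x / A⌋₊, (∑ a ∈ Ioc ⌊A⌋₊ ⌊2 * A⌋₊, entry c a b * entry c a b') ^ 2) := hms
      _ ≤ 1 * Real.sqrt (∑ b ∈ Icc 1 ⌊x / A⌋₊,
            ∑ b' ∈ Icc 1 ⌊x / A⌋₊, (∑ a ∈ Ioc ⌊A⌋₊ ⌊2 * A⌋₊, entry c a b * entry c a b') ^ 2) :=
          mul_le_mul_of_nonneg_right hv hsqrtT0
      _ ≤ Real.sqrt (x ^ 2 / Real.log x ^ (4 * C)) := by
          rw [one_mul]; exact Real.sqrt_le_sqrt hT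
  -- `|uᵀ M v|² ≤ ‖u‖² ‖M v‖²`
  have hbil : ∑ a ∈ Ioc ⌊A⌋₊ ⌊2 * A⌋₊, ∑ b ∈ Icc 1 ⌊x / A⌋₊, u a * v b * entry c a b =
      ∑ a ∈ Ioc ⌊A⌋₊ ⌊2 * A⌋₊, u a * m a := by
    refine sum_congr rfl fun a _ => ?_
    rw [hm_def]
    dsimp only
    rw [mul_sum]
    refine sum_congr rfl fun b _ => ?_
    ring
  have hCS : (∑ a ∈ Ioc ⌊A⌋₊ ⌊2 * A⌋₊, u a * m a) ^ 2 ≤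
      (∑ a ∈ Ioc ⌊A⌋₊ ⌊2 * A⌋₊, u a ^ 2) * ∑ a ∈ Ioc ⌊A⌋₊ ⌊2 * A⌋₊, m a ^ 2 :=
    sum_mul_sq_le_sq_mul_sq _ _ _
  have hm0 : 0 ≤ ∑ a ∈ Ioc ⌊A⌋₊ ⌊2 * A⌋₊, m a ^ 2 := sum_nonneg fun _ _ => sq_nonneg _
  have hsq : (∑ a ∈ Ioc ⌊A⌋₊ ⌊2 * A⌋₊, u a * m a) ^ 2 ≤
      Real.sqrt (x ^ 2 / Real.log x ^ (4 * C)) :=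
    calc (∑ a ∈ Ioc ⌊A⌋₊ ⌊2 * A⌋₊, u a * m a) ^ 2
        ≤ (∑ a ∈ Ioc ⌊A⌋₊ ⌊2 * A⌋₊, u a ^ 2) * ∑ a ∈ Ioc ⌊A⌋₊ ⌊2 * A⌋₊, m a ^ 2 := hCS
      _ ≤ 1 * ∑ a ∈ Ioc ⌊A⌋₊ ⌊2 * A⌋₊, m a ^ 2 := mul_le_mul_of_nonneg_right hu hm0
      _ ≤ Real.sqrt (x ^ 2 / Real.log x ^ (4 * C)) := by rw [one_mul]; exact hMv
  -- numerics: `√(√(x²/L^{4C})) = √x/L^C`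
  have hLC0 : 0 ≤ Real.log x ^ C := Real.rpow_nonneg hL0 C
  have h4 : Real.log x ^ (4 * C) = ((Real.log x ^ C) ^ 2) ^ 2 := by
    rw [mul_comm, Real.rpow_mul hL0, show (4 : ℝ) = 2 * 2 by norm_num, Real.rpow_mul hLC0,
      Real.rpow_two, Real.rpow_two]
  have hroot : Real.sqrt (Real.sqrt (x ^ 2 / Real.log x ^ (4 * C))) =
      x ^ (1 / 2 : ℝ) / Real.log x ^ C := by
    rw [h4, ← div_pow, Real.sqrt_sq (div_nonneg hx0 (sq_nonneg _)), Real.sqrt_div' x (sq_nonneg _),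
      Real.sqrt_sq hLC0, Real.sqrt_eq_rpow]
  rw [hbil, ← hroot]
  exact Real.abs_le_sqrt hsq

/-- Under the crux the inverse theorem holds vacuously (its hypothesis never fires beyond `x₀`). -/
theorem inverseCM_of_operatorNormForm (hop : OperatorNormForm) : InverseCM := by
  intro c hc δ hδ hδ' C hC
  obtain ⟨x₁, h1⟩ := hop c hc δ hδ hδ' (C + 1) (by linarith)
  refine ⟨1, one_pos, max x₁ 3, ?_⟩
  intro x hx A hA hA' u v hu hv hbig
  exfalso
  have hx₁ : x₁ ≤ x := le_trans (le_max_left _ _) hx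
  have hx3 : (3 : ℝ) ≤ x := le_trans (le_max_right _ _) hx
  have hxpos : 0 < x := by linarith
  have hsmall := h1 x hx₁ A hA hA' u v hu hv
  have hlog : 1 < Real.log x := by
    have he : Real.exp 1 < x :=
      lt_of_lt_of_le (lt_trans Real.exp_one_lt_d9 (by norm_num)) hx3
    exact (Real.lt_log_iff_exp_lt hxpos).2 he
  have hLpos : 0 < Real.log x := by linarith
  have hpow : Real.log x ^ C < Real.log x ^ (C + 1) :=
    Real.rpow_lt_rpow_of_exponent_lt hlog (by linarith)
  have hnum : 0 < x ^ (1 / 2 : ℝ) := Real.rpow_pos_of_pos hxpos _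
  have hlt : x ^ (1 / 2 : ℝ) / Real.log x ^ (C + 1) < x ^ (1 / 2 : ℝ) / Real.log x ^ C :=
    div_lt_div_of_pos_left hnum (Real.rpow_pos_of_pos hLpos C) hpow
  linarith

theorem inverseCM_of_tableChowla (hTC : TableChowla) : InverseCM :=
  inverseCM_of_operatorNormForm (operatorNormForm_of_tableChowla hTC)

/-- EXACT SPLITTING (r3): the crux is equivalent to the conjunction of the two open registered stubs'
statements — the lever and the WHOLE residual. -/
theorem tableChowla_iff_stubs : TableChowla ↔ (InverseCM ∧ MeanSquareCM) :=
  ⟨fun h => ⟨inverseCM_of_tableChowla h, meanSquareCM_of_tableChowla h⟩,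
    fun h => Negative.tableChowla_iff.mpr (tableChowlaFor_of_stubs h.1 h.2)⟩

end Converse


/-! ## Exactness of the r5 anatomy (real proofs): each piece follows from the crux -/

section AnatomyExact

open Finset
open Summit.Parity.GeneralizedHardyLittlewood.Theorems.TableChowla

/-- The core from the crux: restrict the column test vector to the free columns (still `ℓ²`-unit) and
apply `C⁺ = OperatorNormForm`. -/
theorem primeCore_of_operatorNormForm (hop : OperatorNormForm) : PrimeCore := by
  intro c hc δ hδ hδ' C hC
  obtain ⟨x₀, h⟩ := hop c hc δ hδ hδ' C hC
  refine ⟨x₀, fun x hx A hA hA' u v hu hv => ?_⟩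
  set P : ℕ → Prop := fun b => b.Prime ∧ ⌊x / A⌋₊ < b * b with hPdef
  set v' : ℕ → ℝ := fun b => if P b then v b else 0 with hv'
  have hv'1 : ∑ b ∈ Icc 1 ⌊x / A⌋₊, v' b ^ 2 ≤ 1 := by
    refine le_trans (sum_le_sum fun b _ => ?_) hv
    simp only [hv']
    split_ifs
    · exact le_rfl
    · rw [zero_pow two_ne_zero]; exact sq_nonneg _
  have heq : ∑ a ∈ Ioc ⌊A⌋₊ ⌊2 * A⌋₊, ∑ b ∈ Icc 1 ⌊x / A⌋₊, u a * v' b * entry c a b =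
      ∑ a ∈ Ioc ⌊A⌋₊ ⌊2 * A⌋₊, ∑ b ∈ (Icc 1 ⌊x / A⌋₊).filter (fun b => P b),
        u a * v b * entry c a b := by
    refine sum_congr rfl fun a _ => ?_
    rw [sum_filter]
    refine sum_congr rfl fun b _ => ?_
    simp only [hv']
    split_ifs <;> simp
  have hb := h x hx A hA hA' u v' hu hv'1
  rwa [heq] at hb

/-- The core follows from the crux. -/
theorem primeCore_of_tableChowla (hTC : TableChowla) : PrimeCore :=
  primeCore_of_operatorNormForm (operatorNormForm_of_tableChowla hTC)

/-- The constrained-column lever from the crux (vacuously: under `C⁺` at level `C+1` the restricted form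
never reaches `√x/(log x)^C` beyond a threshold). -/
theorem inverseCompositeCols_of_operatorNormForm (hop : OperatorNormForm) : InverseCompositeCols := by
  intro c hc δ hδ hδ' C hC
  obtain ⟨x₁, h1⟩ := hop c hc δ hδ hδ' (C + 1) (by linarith)
  refine ⟨1, one_pos, max x₁ 3, ?_⟩
  intro x hx A hA hA' u v hu hv hbig
  exfalso
  have hx₁ : x₁ ≤ x := le_trans (le_max_left _ _) hx
  have hx3 : (3 : ℝ) ≤ x := le_trans (le_max_right _ _) hx
  have hxpos : 0 < x := by linarith
  set P : ℕ → Prop := fun b => b.Prime ∧ ⌊x / A⌋₊ < b * b with hPdef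
  set v' : ℕ → ℝ := fun b => if P b then 0 else v b with hv'
  have hv'1 : ∑ b ∈ Icc 1 ⌊x / A⌋₊, v' b ^ 2 ≤ 1 := by
    refine le_trans (sum_le_sum fun b _ => ?_) hv
    simp only [hv']
    split_ifs
    · rw [zero_pow two_ne_zero]; exact sq_nonneg _
    · exact le_rfl
  have heq : ∑ a ∈ Ioc ⌊A⌋₊ ⌊2 * A⌋₊, ∑ b ∈ Icc 1 ⌊x / A⌋₊, u a * v' b * entry c a b =
      ∑ a ∈ Ioc ⌊A⌋₊ ⌊2 * A⌋₊, ∑ b ∈ (Icc 1 ⌊x / A⌋₊).filter (fun b => ¬ P b),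
        u a * v b * entry c a b := by
    refine sum_congr rfl fun a _ => ?_
    rw [sum_filter]
    refine sum_congr rfl fun b _ => ?_
    simp only [hv']
    split_ifs <;> simp
  have hsmall := h1 x hx₁ A hA hA' u v' hu hv'1
  rw [heq] at hsmall
  have hlog : 1 < Real.log x := by
    have he : Real.exp 1 < x := lt_of_lt_of_le (lt_trans Real.exp_one_lt_d9 (by norm_num)) hx3
    exact (Real.lt_log_iff_exp_lt hxpos).2 he
  have hLpos : 0 < Real.log x := by linarith
  have hpow : Real.log x ^ C < Real.log x ^ (C + 1) :=
    Real.rpow_lt_rpow_of_exponent_lt hlog (by linarith)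
  have hnum : 0 < x ^ (1 / 2 : ℝ) := Real.rpow_pos_of_pos hxpos _
  have hlt : x ^ (1 / 2 : ℝ) / Real.log x ^ (C + 1) < x ^ (1 / 2 : ℝ) / Real.log x ^ C :=
    div_lt_div_of_pos_left hnum (Real.rpow_pos_of_pos hLpos C) hpow
  linarith

/-- The constrained-column lever follows from the crux. -/
theorem inverseCompositeCols_of_tableChowla (hTC : TableChowla) : InverseCompositeCols :=
  inverseCompositeCols_of_operatorNormForm (operatorNormForm_of_tableChowla hTC)

/-- The constrained-column residual from the crux: the crux gives the mean-square bound for EVERY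
1-bounded weight (`Negative.meanSquareBounded_iff`, landed), in particular for `g·𝟙_{Sᶜ}`. -/
theorem residualCompositeCols_of_tableChowla (hTC : TableChowla) : ResidualCompositeCols := by
  intro c hc δ hδ hδ' C hC
  obtain ⟨x₀, h⟩ := Negative.meanSquareBounded_iff.mpr hTC c hc δ hδ hδ' C hC
  refine ⟨x₀, fun x hx A hA hA' g _ hgb y hy => ?_⟩
  set P : ℕ → Prop := fun b => b.Prime ∧ ⌊x / A⌋₊ < b * b with hPdef
  set g' : ℕ → ℂ := fun b => if P b then 0 else g b with hg'
  have hg'b : ∀ n, ‖g' n‖ ≤ 1 := fun n => by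
    simp only [hg']
    split_ifs
    · simp
    · exact hgb n
  have hb := h x hx A hA hA' g' hg'b y hy
  have heq : ∀ a, ∑ b ∈ Icc 1 ⌊y⌋₊, g' b * (Negative.entry c a b : ℂ) =
      ∑ b ∈ (Icc 1 ⌊y⌋₊).filter (fun b => ¬ P b), g b * (entry c a b : ℂ) := by
    intro a
    rw [sum_filter]
    refine sum_congr rfl fun b _ => ?_
    simp only [hg']
    split_ifs <;> simp [Negative.entry, entry]
  simp_rw [heq] at hb
  exact hb

/-- EXACT ANATOMY (r5): the crux is equivalent to the conjunction of the three open registered stubs'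
statements — the unstructured core on the free columns, and the Helson split on the constrained ones. -/
theorem tableChowla_iff_anatomy :
    TableChowla ↔ (PrimeCore ∧ InverseCompositeCols ∧ ResidualCompositeCols) :=
  ⟨fun h => ⟨primeCore_of_tableChowla h, inverseCompositeCols_of_tableChowla h,
      residualCompositeCols_of_tableChowla h⟩,
    fun h => Negative.tableChowla_iff.mpr
      (tableChowlaFor_of_stubs (inverseCM_of_primeCols_compositeCols inversePrimeCols_holds h.2.1)
        (meanSquareCM_of_primeCore_compositeCols h.1 h.2.2))⟩

end AnatomyExact

end Summit.Parity.GeneralizedHardyLittlewood.Cruxes.TableChowla.HelsonKroneckerInverse
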